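import Literature.Barriers.ABC.BakerMethodBoundsStewartYuProofs
import Literature.NumberTheory.DiophantineGeometry.MultiplicativeGroupApproximationGenericInputsProofs
import HarnessLib

/-!
# Proofs for `BakerMethodBounds`, III: the archimedean input may have ANY constant

`Literature/Barriers/ABC/BakerMethodBoundsWeakArchProofs.lean` — third proofs companion of the
barrier file `Literature/Barriers/ABC/BakerMethodBounds.lean` (theorems only: no definition, no
named fact). `BakerMethodBounds = BakerShapeBound (1/3) 3` is Stewart–Yu 2001, Theorem 1:
`log c ≤ κ · R^{1/3} (log R)³` for coprime positive `a + b = c`, `R = rad(abc)`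
[cite: StewartYu2001, Theorem 1]. Files I–II (`…ThreeRoutesProofs`, `…StewartYuProofs`) prove it
from `Dioph.PastenApproximationBound K` — lower bounds for linear forms in logarithms over `ℚ` at
ALL places with a simply-exponential constant `K^n` (Evertse–Győry's Theorem 4.2.1 over `ℚ`,
i.e. Matveev 2000 + Yu 2007). This file separates the places and proves that the archimedean
half of that input can be weakened to a lower bound with an ARBITRARY constant:

* `bakerShapeBound_third_three_of_padicClause_archBound` /
  `BakerMethodBounds_of_padicClause_archBound`: `BakerMethodBounds` follows from
  (P) the `p`-adic clause (ii) of Pasten's Theorem 2.1 alone, with any absolute `K ≥ 1`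
      (`ord_p(1 − ξ) log p < K^m (p/log p) log max{e, p h(ξ)} ∏ h(ξⱼ)`), and
  (A) ANY lower bound `log |b₁ log α₁ + ⋯ + bₙ log αₙ| > −C(n) A₁⋯Aₙ log(eB)` for positive
      rationals `αₖ ≠ 1`, `2 ≤ n ≤ 4`, `Aₖ ≥ max{h(αₖ), |log αₖ|, 0.16}`, `B ≥ max{1, |bₖ|}`,
      with an arbitrary function `C : ℕ → ℝ≥0` (no growth condition in `n`, and only linear
      forms in at most four logarithms are ever used);
* `BakerMethodBounds_of_thm328Finite_archBound`: (P) is supplied by the FINITE-place half of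
  Evertse–Győry's Theorem 3.2.8 over `ℚ` (`evertseGyory_finite_of_thm328_finite`,
  `padicClause_of_thm328_finite`: the book's §4.4 and Pasten's deduction run at the primes only);
* `BakerMethodBounds_of_yu_archBound`, `stewart_yu_of_yu_archBound`: hence from Yu's
  Theorem 3.2.7 over `ℚ` as printed (the hypothesis of `Dioph.thm328_rat_finite_of_yu`) plus (A);
* `BakerMethodBounds_of_archBound_padicBound`: and from the two generic binders of
  `Dioph.evertseGyory_thm_4_2_1_rat_of_archBound_padicBound` with the growth condition
  `C(n) ≤ 2^{6n+20}` on the archimedean constant REMOVED (`archBound_crude_of_refined`).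

So the undischarged input of the barrier declaration at the infinite place is no longer
Matveev's theorem: any explicit Baker-type bound over `ℚ` in at most four logarithms with the
product-of-heights dependence (Baker–Wüstholz 1993 = [BakerWustholz2007, Thm 7.1], Waldschmidt
1980, …) suffices; the exponent `1/3` is carried entirely by the `p`-adic estimates with a
simply-exponential constant (Yu), which remain the one deep input.

## Why this is the source's proof line

Stewart–Yu 2001 prove Theorem 1 with Yu's `p`-adic estimates (group varieties II, 1999) and an
archimedean estimate whose constant is of quality `n^{2n}`, not `C^n` (their references are
Waldschmidt 1980 and Baker's 1998 Eger survey — zbMATH 1036.11032; Baker–Wüstholz describe the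
result as "based on the archimedean estimate … Theorem 7.1 and the non-archimedean analogues of
Kunrui Yu" [cite: BakerWustholz2007, §3.7 p. 69]). An `n^{2n}` archimedean constant is fatal for
the naive three-routes accounting of file I when `a` is small and `bc` has many small primes
(`n^{2n} ≈ R^{2−o(1)}`), so the printed argument necessarily confines the archimedean estimate to
few logarithms. The paper itself is not held (paywalled; acquisition request `acq-00895` answered
cite-only), and the deduction below is a RECONSTRUCTION with exactly this property, in the
packaging of files I–II (Pasten's `Θ`, Evertse–Győry's constants); the statement proved is the
vendored one, the constants and the bookkeeping are not claimed to be the paper's.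

## Architecture

W.l.o.g. `a ≤ b`; the triple `1 + 1 = 2` is treated directly; `Y = log max{e, 2 log c}`,
`Λ = max{1, log R}`.
1. *First regime `c ≤ a²`* (`log_pow_three_le_of_le_sq`, `log_le_of_le_sq`). Then
   `log c ≤ 2 log a`, `log c ≤ 2 log b`, so the three routes of file I need no archimedean clause:
   `log w ≤ Θ_{uv} · Y · 3 ∑_{p ∣ w} p` for each member `w` from the `p`-adic clause at the
   primes of `w` (`log_le_route_a₂`, `log_lt_route_c₂`, copies of file I run on clause (ii)
   alone), the cube `(log c)³ ≤ 8 (log a)(log b)(log c)`, the accounting `member_accounting` and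
   `le_of_cube_le` of files I–II: `log c ≤ κ₁ R^{1/3} (log R)³`.
2. *Second regime `a² < c`* (`log_le_of_sq_lt`). Then `log c < 2 (log c − log a) ≤ 2 − 2 log Λ₀`
   with `Λ₀ = log(c/b) ∈ (0, a/b]`. Split the primes of `bc` at `R^{1/4}`: at most three are
   larger (`card_le_three_of_quarter_lt`), and `c/b = β · ∏_{q > R^{1/4}} q^{e_q}` with `β` the
   `R^{1/4}`-smooth part. The archimedean bound (A) for the `≤ 4` generators `{q > R^{1/4}} ∪ {β}`
   (`arch_lower_bound_beta`, `arch_lower_bound_one`; degenerate cases by hand) gives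
   `−log Λ₀ < C(n) Λ³ max{1, h(β)} · 4Y`, and the `p`-adic clause at the SMALL primes pays for
   the height of the smooth part: `h(β) ≤ ∑_{q ≤ R^{1/4}} (ν_q(b) + ν_q(c)) log q ≤ 6 K J² R^{1/4} Y`
   (`logHeight₁_smooth_le`), where `J = ∏_{q ∣ abc} 2K max{1, log q} ≤ C₁ R^{1/48}`
   (`exists_prod_two_mul_max_log_le`: primes beat `2K log q`). Hence
   `log c ≤ M₀ R^{7/24} Λ³ Y²`, and the self-improvement `y ≤ M Y² ⟹ y ≤ 4M log²(32M)`
   (`le_of_le_mul_log_max_sq`, `regimeII_endgame`) gives `log c ≤ κ₂ R^{1/3} (log R)³`.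
3. *Adapters and assembly* (`evertseGyory_finite_of_thm328_finite`,
   `padicClause_of_thm328_finite`, `bakerShapeBound_third_three_of_padicClause_archBound` and
   its corollaries).

## References

* [StewartYu2001] C. L. Stewart, K. Yu, *On the abc conjecture, II*, Duke Math. J. 108 (2001),
  169–181, doi:10.1215/S0012-7094-01-10815-6 — Theorem 1.
* [EvertseGyory2015] J.-H. Evertse, K. Győry, *Unit Equations in Diophantine Number Theory*,
  CUP 2015 — Thm 3.2.4 (p. 61), Thm 3.2.7 (p. 62), Thm 3.2.8 (p. 62), Thm 4.2.1 (p. 68), proof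
  of Thm 4.2.1 (pp. 80–81).
* [Pasten2024] H. Pasten, Invent. Math. 236 (2024), 373–385 — Theorem 2.1.
* [BakerWustholz2007] A. Baker, G. Wüstholz, *Logarithmic Forms and Diophantine Geometry*,
  CUP 2007 — §3.7 (pp. 66–70), Thm 7.1 (p. 125).
* [Yu2007] K. Yu, *p-adic logarithmic forms and group varieties. III*, Forum Math. 19 (2007),
  187–280.
-/

noncomputable section

open Finset Real Height
open Literature.NumberTheory.DiophantineGeometry
open Literature.NumberTheory.DiophantineGeometry.Dioph
open Literature.NumberTheory.DiophantineGeometry.Pasten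

namespace Literature.Barriers.ABC

/-! ### The `p`-adic clause of the approximation bound, on its own -/

section PadicClause

variable {K : ℝ}

/-- **The `p`-adic clause for a generator family** (the second half of `Pasten.approx_of_family`,
run on the `p`-adic clause alone): monotonicity in the number of generators `m ≥ #ι` and in
`Θ ≥ ∏ h(ξᵢ)` (`K ≥ 1`). [cite: Pasten2024, Theorem 2.1 (ii)] -/
theorem padic_approx_of_family (hK : 1 ≤ K)
    (hP2 : ∀ (ι : Type) [Fintype ι], 0 < Fintype.card ι →
      ∀ ξ : ι → ℚ, (∀ i, ξ i ≠ 0 ∧ ξ i ≠ 1 ∧ ξ i ≠ -1) →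
      ∀ ζ : ℚ, (ζ = 1 ∨ ζ = -1) → ∀ b : ι → ℤ, ζ * ∏ i, ξ i ^ b i ≠ 1 →
      ∀ p : ℕ, p.Prime →
        (padicValRat p (1 - ζ * ∏ i, ξ i ^ b i) : ℝ) * Real.log p <
          K ^ Fintype.card ι * (p / Real.log p) *
            Real.log (max (Real.exp 1) (p * logHeight₁ (ζ * ∏ i, ξ i ^ b i))) *
            ∏ i, logHeight₁ (ξ i))
    (ι : Type) [Fintype ι] (hι : 0 < Fintype.card ι) (ξs : ι → ℚ)
    (hξs : ∀ i, ξs i ≠ 0 ∧ ξs i ≠ 1 ∧ ξs i ≠ -1) (ζ : ℚ) (hζ : ζ = 1 ∨ ζ = -1) (b : ι → ℤ)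
    {ξ : ℚ} (hprod : ζ * ∏ i, ξs i ^ b i = ξ) (hξ1 : ξ ≠ 1)
    {m : ℕ} (hm : Fintype.card ι ≤ m) {Θ : ℝ} (hΘ : ∏ i, logHeight₁ (ξs i) ≤ Θ)
    {p : ℕ} (hp : p.Prime) :
    (padicValRat p (1 - ξ) : ℝ) * Real.log p <
        K ^ m * Θ * ((p / Real.log p) * Real.log (max (Real.exp 1) (p * logHeight₁ ξ))) := by
  have hx1 : ζ * ∏ i, ξs i ^ b i ≠ 1 := by rwa [hprod]
  have hN := hP2 ι hι ξs hξs ζ hζ b hx1 p hp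
  rw [hprod] at hN
  have hΘ0 : 0 ≤ ∏ i, logHeight₁ (ξs i) := Finset.prod_nonneg fun i _ => zero_le_logHeight₁ _
  have hK0 : 0 ≤ K := zero_le_one.trans hK
  have hKm : K ^ Fintype.card ι ≤ K ^ m := pow_le_pow_right₀ hK hm
  have hp0 : (0 : ℝ) < p := by exact_mod_cast hp.pos
  have hlogp : 0 < Real.log p := Real.log_pos (by exact_mod_cast hp.one_lt)
  have h1 := one_le_log_max_exp (p * logHeight₁ ξ)
  have hpl : 0 ≤ (p : ℝ) / Real.log p := by positivity
  calc (padicValRat p (1 - ξ) : ℝ) * Real.log p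
      < K ^ Fintype.card ι * (p / Real.log p) *
          Real.log (max (Real.exp 1) (p * logHeight₁ ξ)) * ∏ i, logHeight₁ (ξs i) := hN
    _ ≤ K ^ m * (p / Real.log p) * Real.log (max (Real.exp 1) (p * logHeight₁ ξ)) * Θ := by
        apply mul_le_mul _ hΘ hΘ0
          (mul_nonneg (mul_nonneg (pow_nonneg hK0 _) hpl) (by linarith))
        apply mul_le_mul_of_nonneg_right _ (by linarith)
        exact mul_le_mul_of_nonneg_right hKm hpl
    _ = _ := by ring

/-- **The `p`-adic clause for `ξ = ζ · ξ₀ · ∏_{p ∈ T} p^{e_p}`** (the second half of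
`Pasten.approx_generic`, from the `p`-adic clause alone): with
`Θ := K^{#T+1} · max(1, h(ξ₀)) · ∏_{p ∈ T} log p`,
`ord_p(1 − ξ) log p < Θ · (p/log p) · log max{e, p h(ξ)}`. [cite: Pasten2024, §4] -/
theorem padic_approx_generic (hK : 1 ≤ K)
    (hP2 : ∀ (ι : Type) [Fintype ι], 0 < Fintype.card ι →
      ∀ ξ : ι → ℚ, (∀ i, ξ i ≠ 0 ∧ ξ i ≠ 1 ∧ ξ i ≠ -1) →
      ∀ ζ : ℚ, (ζ = 1 ∨ ζ = -1) → ∀ b : ι → ℤ, ζ * ∏ i, ξ i ^ b i ≠ 1 →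
      ∀ p : ℕ, p.Prime →
        (padicValRat p (1 - ζ * ∏ i, ξ i ^ b i) : ℝ) * Real.log p <
          K ^ Fintype.card ι * (p / Real.log p) *
            Real.log (max (Real.exp 1) (p * logHeight₁ (ζ * ∏ i, ξ i ^ b i))) *
            ∏ i, logHeight₁ (ξ i))
    (T : Finset ℕ) (hT : ∀ p ∈ T, p.Prime) (e : ℕ → ℤ) {ξ₀ : ℚ} (hξ₀ : 0 < ξ₀)
    (hne : T = ∅ → ξ₀ ≠ 1) {ζ : ℚ} (hζ : ζ = 1 ∨ ζ = -1) {ξ : ℚ}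
    (hξ : ξ = ζ * (ξ₀ * ∏ p ∈ T, (p : ℚ) ^ e p)) (hξ1 : ξ ≠ 1) {p : ℕ} (hp : p.Prime) :
    (padicValRat p (1 - ξ) : ℝ) * Real.log p <
        K ^ (T.card + 1) * (max 1 (logHeight₁ ξ₀) * ∏ p ∈ T, Real.log p) *
          ((p / Real.log p) * Real.log (max (Real.exp 1) (p * logHeight₁ ξ))) := by
  classical
  have hgenT : ∀ p ∈ T, ((p : ℕ) : ℚ) ≠ 0 ∧ ((p : ℕ) : ℚ) ≠ 1 ∧ ((p : ℕ) : ℚ) ≠ -1 := by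
    intro p hp
    have hp' := hT p hp
    refine ⟨by exact_mod_cast hp'.ne_zero, by exact_mod_cast hp'.one_lt.ne', fun h => ?_⟩
    have h0 : (0 : ℚ) ≤ (p : ℚ) := Nat.cast_nonneg p
    rw [h] at h0
    norm_num at h0
  have hhT : ∀ p ∈ T, logHeight₁ ((p : ℕ) : ℚ) = Real.log p := by
    intro p hp
    haveI : NeZero p := ⟨(hT p hp).ne_zero⟩
    exact Rat.logHeight₁_natCast p
  have hlog0 : 0 ≤ ∏ p ∈ T, Real.log p := Finset.prod_nonneg fun p hp =>
    Real.log_nonneg (by exact_mod_cast (hT p hp).one_lt.le)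
  by_cases h1 : ξ₀ = 1
  · have hTne : T.Nonempty := by
      rw [Finset.nonempty_iff_ne_empty]
      intro hc
      exact hne hc h1
    have hcard : 0 < Fintype.card T := by
      rw [Fintype.card_coe]; exact hTne.card_pos
    have hprod : ζ * ∏ i : T, (((i : ℕ) : ℚ)) ^ e i = ξ := by
      rw [hξ, h1, one_mul, Finset.prod_coe_sort T fun p => (p : ℚ) ^ e p]
    have hh : ∏ i : T, logHeight₁ (((i : ℕ) : ℚ)) ≤
        max 1 (logHeight₁ ξ₀) * ∏ p ∈ T, Real.log p := by
      rw [Finset.prod_coe_sort T fun p => logHeight₁ ((p : ℕ) : ℚ), Finset.prod_congr rfl hhT]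
      exact le_mul_of_one_le_left hlog0 (le_max_left _ _)
    exact padic_approx_of_family hK hP2 T hcard (fun i => ((i : ℕ) : ℚ)) (fun i => hgenT i i.2)
      ζ hζ (fun i => e i) hprod hξ1 (by rw [Fintype.card_coe]; exact Nat.le_succ _) hh hp
  · have hcard : 0 < Fintype.card (Option T) := Fintype.card_pos
    set ξs : Option T → ℚ := fun o => o.elim ξ₀ fun i => ((i : ℕ) : ℚ) with hξs
    set b : Option T → ℤ := fun o => o.elim 1 fun i => e i with hb
    have hgen : ∀ o, ξs o ≠ 0 ∧ ξs o ≠ 1 ∧ ξs o ≠ -1 := by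
      rintro (_ | i)
      · exact ⟨hξ₀.ne', h1, fun h => by simp only [hξs, Option.elim] at h; linarith⟩
      · exact hgenT i i.2
    have hprod : ζ * ∏ o, ξs o ^ b o = ξ := by
      rw [Fintype.prod_option]
      simp only [hξs, hb, Option.elim, zpow_one]
      rw [hξ, Finset.prod_coe_sort T fun p => (p : ℚ) ^ e p]
    have hh : ∏ o, logHeight₁ (ξs o) ≤ max 1 (logHeight₁ ξ₀) * ∏ p ∈ T, Real.log p := by
      rw [Fintype.prod_option]
      simp only [hξs, Option.elim]
      rw [Finset.prod_coe_sort T fun p => logHeight₁ ((p : ℕ) : ℚ), Finset.prod_congr rfl hhT]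
      exact mul_le_mul_of_nonneg_right (le_max_right _ _) hlog0
    exact padic_approx_of_family hK hP2 (Option T) hcard ξs hgen ζ hζ b hprod hξ1
      (by rw [Fintype.card_option, Fintype.card_coe]) hh hp

/-- **The `p`-adic clause for `ξ = ±u/v`** (`u, v` coprime positive, `uv > 1`, `ξ ≠ 1`), any
threshold `N`: `ord_p(1 − ξ) · log p < Θ · (p/log p) · log max{e, p·h(ξ)}` with
`Θ = theta K u v N` (the second half of `Pasten.approx_div`). [cite: Pasten2024, §4] -/
theorem padic_approx_div (hK : 1 ≤ K)
    (hP2 : ∀ (ι : Type) [Fintype ι], 0 < Fintype.card ι →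
      ∀ ξ : ι → ℚ, (∀ i, ξ i ≠ 0 ∧ ξ i ≠ 1 ∧ ξ i ≠ -1) →
      ∀ ζ : ℚ, (ζ = 1 ∨ ζ = -1) → ∀ b : ι → ℤ, ζ * ∏ i, ξ i ^ b i ≠ 1 →
      ∀ p : ℕ, p.Prime →
        (padicValRat p (1 - ζ * ∏ i, ξ i ^ b i) : ℝ) * Real.log p <
          K ^ Fintype.card ι * (p / Real.log p) *
            Real.log (max (Real.exp 1) (p * logHeight₁ (ζ * ∏ i, ξ i ^ b i))) *
            ∏ i, logHeight₁ (ξ i))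
    {u v : ℕ} (hu : u ≠ 0) (hv : v ≠ 0) (huv : u.Coprime v) (h1 : 1 < u * v) (N : ℕ) {ζ : ℚ}
    (hζ : ζ = 1 ∨ ζ = -1) (hξ1 : ζ * ((u : ℚ) / v) ≠ 1) {p : ℕ} (hp : p.Prime) :
    (padicValRat p (1 - ζ * ((u : ℚ) / v)) : ℝ) * Real.log p <
        theta K u v N *
          ((p / Real.log p) * Real.log (max (Real.exp 1) (p * logHeight₁ (ζ * ((u : ℚ) / v))))) :=
  padic_approx_generic hK hP2 (bigPrimes u v N) (fun _ hp => prime_of_mem_bigPrimes hp)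
    (expDiff u v) (cofactor_pos u v N) (fun hT => cofactor_ne_one hu hv huv hT h1) hζ
    (by rw [← cast_div_eq_cofactor_mul_prod hu hv huv N]) hξ1 hp

variable {a b c : ℕ}

/-- **A prime `p ∣ a`, `ξ = b/c`, from the `p`-adic clause alone:**
`ν_p(a) · log p < Θ_{b,c} · (p / log p) · (log p + log max{e, 2 log c})`
(`ord_p(1 − ξ) = ord_p(a/c) = ν_p(a)`; copy of `Pasten.padic_bound_a`). [cite: Pasten2024, §5] -/
theorem padic_bound_a₂ (hK : 1 ≤ K)
    (hP2 : ∀ (ι : Type) [Fintype ι], 0 < Fintype.card ι →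
      ∀ ξ : ι → ℚ, (∀ i, ξ i ≠ 0 ∧ ξ i ≠ 1 ∧ ξ i ≠ -1) →
      ∀ ζ : ℚ, (ζ = 1 ∨ ζ = -1) → ∀ b : ι → ℤ, ζ * ∏ i, ξ i ^ b i ≠ 1 →
      ∀ p : ℕ, p.Prime →
        (padicValRat p (1 - ζ * ∏ i, ξ i ^ b i) : ℝ) * Real.log p <
          K ^ Fintype.card ι * (p / Real.log p) *
            Real.log (max (Real.exp 1) (p * logHeight₁ (ζ * ∏ i, ξ i ^ b i))) *
            ∏ i, logHeight₁ (ξ i))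
    (h : IsABCTriple a b c) (N : ℕ) {p : ℕ} (hp : p.Prime) (hpa : p ∣ a) :
    (a.factorization p : ℝ) * Real.log p < theta K b c N *
      ((p / Real.log p) * (Real.log p + Real.log (max (Real.exp 1) (2 * Real.log c)))) := by
  obtain ⟨ha, hb, habc, hcop⟩ := h
  have hc : 0 < c := by omega
  have hbc : b.Coprime c := coprime_right_of_isABCTriple ⟨ha, hb, habc, hcop⟩
  have hac : a.Coprime c := coprime_left_of_isABCTriple ⟨ha, hb, habc, hcop⟩
  have h1 : 1 < b * c := by nlinarith
  have hc' : (c : ℚ) ≠ 0 := by exact_mod_cast hc.ne'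
  have hξ1 : (1 : ℚ) * ((b : ℚ) / c) ≠ 1 := by
    rw [one_mul, Ne, div_eq_one_iff_eq hc']
    exact_mod_cast (show b ≠ c by omega)
  have hNp := padic_approx_div hK hP2 hb.ne' hc.ne' hbc h1 N (Or.inl rfl) hξ1 hp
  have hsub : (1 : ℚ) - 1 * ((b : ℚ) / c) = (a : ℚ) / c := by
    rw [one_mul, eq_div_iff hc', sub_mul, div_mul_cancel₀ _ hc', one_mul]
    exact_mod_cast (show (c : ℤ) - b = a by omega)
  rw [hsub] at hNp
  have hpc : ¬p ∣ c := fun hpc =>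
    hp.one_lt.ne' (Nat.dvd_one.mp (hac.gcd_eq_one ▸ Nat.dvd_gcd hpa hpc))
  have hval : padicValRat p ((a : ℚ) / c) = a.factorization p := by
    haveI : Fact p.Prime := ⟨hp⟩
    rw [padicValRat.div (by exact_mod_cast ha.ne') hc', padicValRat.of_nat, padicValRat.of_nat,
      padicValNat.eq_zero_of_not_dvd hpc, Nat.factorization_def a hp]
    simp
  rw [hval] at hNp
  push_cast at hNp
  have hh : logHeight₁ (1 * ((b : ℚ) / c)) ≤ 2 * Real.log c := by
    refine (logHeight₁_sign_mul_div_le hb.ne' hc.ne' (Or.inl rfl)).trans ?_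
    have : Real.log b ≤ Real.log c :=
      Real.log_le_log (by exact_mod_cast hb) (by exact_mod_cast (show b ≤ c by omega))
    linarith
  have hΘ := theta_nonneg (zero_le_one.trans hK) b c N
  have hp1 : (1 : ℝ) ≤ p := by exact_mod_cast hp.one_lt.le
  have hpl : 0 ≤ (p : ℝ) / Real.log p :=
    div_nonneg (by linarith) (Real.log_nonneg hp1)
  refine hNp.trans_le (mul_le_mul_of_nonneg_left (mul_le_mul_of_nonneg_left ?_ hpl) hΘ)
  exact (log_max_exp_mul_le hp1).trans (by linarith [log_max_exp_mono (t₁ := logHeight₁ (1 * ((b : ℚ) / c))) hh])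

/-- **A prime `p ∣ c`, `ξ = −a/b`, from the `p`-adic clause alone:**
`ν_p(c) · log p < Θ_{a,b} · (p / log p) · (log p + log max{e, 2 log c})` (needs `ab > 1`;
copy of `Pasten.padic_bound_c`). [cite: Pasten2024, §5] -/
theorem padic_bound_c₂ (hK : 1 ≤ K)
    (hP2 : ∀ (ι : Type) [Fintype ι], 0 < Fintype.card ι →
      ∀ ξ : ι → ℚ, (∀ i, ξ i ≠ 0 ∧ ξ i ≠ 1 ∧ ξ i ≠ -1) →
      ∀ ζ : ℚ, (ζ = 1 ∨ ζ = -1) → ∀ b : ι → ℤ, ζ * ∏ i, ξ i ^ b i ≠ 1 →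
      ∀ p : ℕ, p.Prime →
        (padicValRat p (1 - ζ * ∏ i, ξ i ^ b i) : ℝ) * Real.log p <
          K ^ Fintype.card ι * (p / Real.log p) *
            Real.log (max (Real.exp 1) (p * logHeight₁ (ζ * ∏ i, ξ i ^ b i))) *
            ∏ i, logHeight₁ (ξ i))
    (h : IsABCTriple a b c) (h1 : 1 < a * b) (N : ℕ) {p : ℕ} (hp : p.Prime) (hpc : p ∣ c) :
    (c.factorization p : ℝ) * Real.log p < theta K a b N *
      ((p / Real.log p) * (Real.log p + Real.log (max (Real.exp 1) (2 * Real.log c)))) := by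
  obtain ⟨ha, hb, habc, hcop⟩ := h
  have hc : 0 < c := by omega
  have hbc : b.Coprime c := coprime_right_of_isABCTriple ⟨ha, hb, habc, hcop⟩
  have hb' : (b : ℚ) ≠ 0 := by exact_mod_cast hb.ne'
  have hξ1 : (-1 : ℚ) * ((a : ℚ) / b) ≠ 1 := by
    intro h'
    have : (0 : ℚ) < (a : ℚ) / b := div_pos (by exact_mod_cast ha) (by exact_mod_cast hb)
    linarith
  have hNp := padic_approx_div hK hP2 ha.ne' hb.ne' hcop h1 N (Or.inr rfl) hξ1 hp
  have hsub : (1 : ℚ) - (-1) * ((a : ℚ) / b) = (c : ℚ) / b := by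
    rw [neg_one_mul, sub_neg_eq_add, eq_div_iff hb', add_mul, div_mul_cancel₀ _ hb', one_mul]
    exact_mod_cast (show b + a = c by omega)
  rw [hsub] at hNp
  have hpb : ¬p ∣ b := fun hpb =>
    hp.one_lt.ne' (Nat.dvd_one.mp (hbc.gcd_eq_one ▸ Nat.dvd_gcd hpb hpc))
  have hval : padicValRat p ((c : ℚ) / b) = c.factorization p := by
    haveI : Fact p.Prime := ⟨hp⟩
    rw [padicValRat.div (by exact_mod_cast hc.ne') hb', padicValRat.of_nat, padicValRat.of_nat,
      padicValNat.eq_zero_of_not_dvd hpb, Nat.factorization_def c hp]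
    simp
  rw [hval] at hNp
  push_cast at hNp
  have hh : logHeight₁ ((-1) * ((a : ℚ) / b)) ≤ 2 * Real.log c := by
    refine (logHeight₁_sign_mul_div_le ha.ne' hb.ne' (Or.inr rfl)).trans ?_
    have h₁ : Real.log a ≤ Real.log c :=
      Real.log_le_log (by exact_mod_cast ha) (by exact_mod_cast (show a ≤ c by omega))
    have h₂ : Real.log b ≤ Real.log c :=
      Real.log_le_log (by exact_mod_cast hb) (by exact_mod_cast (show b ≤ c by omega))
    linarith
  have hΘ := theta_nonneg (zero_le_one.trans hK) a b N
  have hp1 : (1 : ℝ) ≤ p := by exact_mod_cast hp.one_lt.le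
  have hpl : 0 ≤ (p : ℝ) / Real.log p :=
    div_nonneg (by linarith) (Real.log_nonneg hp1)
  refine hNp.trans_le (mul_le_mul_of_nonneg_left (mul_le_mul_of_nonneg_left ?_ hpl) hΘ)
  exact (log_max_exp_mul_le hp1).trans
    (by linarith [log_max_exp_mono (t₁ := logHeight₁ ((-1) * ((a : ℚ) / b))) hh])

/-- **Route through `a`, `p`-adic part only:** `log a ≤ Θ_{bc} · Y · 3 ∑_{p ∣ a} p` with
`Θ_{bc} = theta K b c 0`, `Y = log max{e, 2 log c}`. [cite: StewartYu2001, §3, as reconstructed] -/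
theorem log_le_route_a₂ (hK : 1 ≤ K)
    (hP2 : ∀ (ι : Type) [Fintype ι], 0 < Fintype.card ι →
      ∀ ξ : ι → ℚ, (∀ i, ξ i ≠ 0 ∧ ξ i ≠ 1 ∧ ξ i ≠ -1) →
      ∀ ζ : ℚ, (ζ = 1 ∨ ζ = -1) → ∀ b : ι → ℤ, ζ * ∏ i, ξ i ^ b i ≠ 1 →
      ∀ p : ℕ, p.Prime →
        (padicValRat p (1 - ζ * ∏ i, ξ i ^ b i) : ℝ) * Real.log p <
          K ^ Fintype.card ι * (p / Real.log p) *
            Real.log (max (Real.exp 1) (p * logHeight₁ (ζ * ∏ i, ξ i ^ b i))) *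
            ∏ i, logHeight₁ (ξ i))
    (h : IsABCTriple a b c) :
    Real.log a ≤ theta K b c 0 * Real.log (max (Real.exp 1) (2 * Real.log c)) *
      (3 * ∑ p ∈ a.primeFactors, (p : ℝ)) := by
  obtain ⟨ha, hb, habc, hcop⟩ := id h
  set Θ := theta K b c 0 with hΘ
  set Y := Real.log (max (Real.exp 1) (2 * Real.log c)) with hY
  have hY1 : 1 ≤ Y := one_le_log_max_exp _
  have hΘ0 : 0 ≤ Θ := theta_nonneg (zero_le_one.trans hK) b c 0
  have hloga : Real.log a = ∑ p ∈ a.primeFactors, (a.factorization p : ℝ) * Real.log p :=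
    log_eq_sum_factorization_mul_log ha.ne'
  have hsum : ∑ p ∈ a.primeFactors, (a.factorization p : ℝ) * Real.log p ≤
      ∑ p ∈ a.primeFactors, Θ * (3 * p * Y) := by
    refine Finset.sum_le_sum fun p hp => ?_
    have hp' := Nat.prime_of_mem_primeFactors hp
    have hpa := Nat.dvd_of_mem_primeFactors hp
    have h1 := padic_bound_a₂ hK hP2 h 0 hp' hpa
    have h2 : (p : ℝ) / Real.log p * (Real.log p + Y) ≤ 3 * p * Y :=
      div_log_mul_add_le (by exact_mod_cast hp'.two_le) hY1
    exact (h1.trans_le (mul_le_mul_of_nonneg_left h2 hΘ0)).le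
  have hsum' : ∑ p ∈ a.primeFactors, Θ * (3 * p * Y) =
      Θ * Y * (3 * ∑ p ∈ a.primeFactors, (p : ℝ)) := by
    rw [Finset.mul_sum, Finset.mul_sum]
    exact Finset.sum_congr rfl fun p _ => by ring
  rw [hloga, ← hsum']; exact hsum

/-- **Route through `c`, from the `p`-adic clause alone** (needs `ab > 1`):
`log c < Θ_{ab} · Y · (1 + 3 ∑_{p ∣ c} p)`. [cite: StewartYu2001, §3, as reconstructed] -/
theorem log_lt_route_c₂ (hK : 1 ≤ K)
    (hP2 : ∀ (ι : Type) [Fintype ι], 0 < Fintype.card ι →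
      ∀ ξ : ι → ℚ, (∀ i, ξ i ≠ 0 ∧ ξ i ≠ 1 ∧ ξ i ≠ -1) →
      ∀ ζ : ℚ, (ζ = 1 ∨ ζ = -1) → ∀ b : ι → ℤ, ζ * ∏ i, ξ i ^ b i ≠ 1 →
      ∀ p : ℕ, p.Prime →
        (padicValRat p (1 - ζ * ∏ i, ξ i ^ b i) : ℝ) * Real.log p <
          K ^ Fintype.card ι * (p / Real.log p) *
            Real.log (max (Real.exp 1) (p * logHeight₁ (ζ * ∏ i, ξ i ^ b i))) *
            ∏ i, logHeight₁ (ξ i))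
    (h : IsABCTriple a b c) (h1 : 1 < a * b) :
    Real.log c < theta K a b 0 * Real.log (max (Real.exp 1) (2 * Real.log c)) *
      (1 + 3 * ∑ p ∈ c.primeFactors, (p : ℝ)) := by
  obtain ⟨ha, hb, habc, hcop⟩ := id h
  set Θ := theta K a b 0 with hΘ
  set Y := Real.log (max (Real.exp 1) (2 * Real.log c)) with hY
  have hc : c ≠ 0 := by omega
  have hY1 : 1 ≤ Y := one_le_log_max_exp _
  have hΘpos : 0 < Θ := theta_zero_pos hK ha.ne' hb.ne' hcop
  have hΘ0 : 0 ≤ Θ := hΘpos.le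
  have hlogc : Real.log c = ∑ p ∈ c.primeFactors, (c.factorization p : ℝ) * Real.log p :=
    log_eq_sum_factorization_mul_log hc
  have hsum : ∑ p ∈ c.primeFactors, (c.factorization p : ℝ) * Real.log p ≤
      ∑ p ∈ c.primeFactors, Θ * (3 * p * Y) := by
    refine Finset.sum_le_sum fun p hp => ?_
    have hp' := Nat.prime_of_mem_primeFactors hp
    have hpc := Nat.dvd_of_mem_primeFactors hp
    have h1' := padic_bound_c₂ hK hP2 h h1 0 hp' hpc
    have h2 : (p : ℝ) / Real.log p * (Real.log p + Y) ≤ 3 * p * Y :=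
      div_log_mul_add_le (by exact_mod_cast hp'.two_le) hY1
    exact (h1'.trans_le (mul_le_mul_of_nonneg_left h2 hΘ0)).le
  have hsum' : ∑ p ∈ c.primeFactors, Θ * (3 * p * Y) =
      Θ * Y * (3 * ∑ p ∈ c.primeFactors, (p : ℝ)) := by
    rw [Finset.mul_sum, Finset.mul_sum]
    exact Finset.sum_congr rfl fun p _ => by ring
  have hΘY : 0 < Θ * Y := mul_pos hΘpos (lt_of_lt_of_le one_pos hY1)
  calc Real.log c = ∑ p ∈ c.primeFactors, (c.factorization p : ℝ) * Real.log p := hlogc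
    _ ≤ Θ * Y * (3 * ∑ p ∈ c.primeFactors, (p : ℝ)) := by rw [← hsum']; exact hsum
    _ < Θ * Y + Θ * Y * (3 * ∑ p ∈ c.primeFactors, (p : ℝ)) := by linarith
    _ = Θ * Y * (1 + 3 * ∑ p ∈ c.primeFactors, (p : ℝ)) := by ring

end PadicClause


/-! ### First regime: `c ≤ a²` (with `a ≤ b`) — three `p`-adic routes, no archimedean input -/

section RegimeOne

variable {K : ℝ} {a b c : ℕ}

/-- **The cube of the three `p`-adic routes when `a ≤ b` and `c ≤ a²`.** Then
`log c ≤ 2 log a` and `log c ≤ 2 log b`, so the archimedean clause is not needed: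
`(log c)³ ≤ 64 K⁹ (2C)³ Λ⁶ Y³ R` with `R = rad(abc)`, `Λ = max(1, log R)`,
`Y = log max{e, 2 log c}`, `C` bounding the products `∏ 4K²(log p)²/p` over finite sets of primes.
[cite: StewartYu2001, Theorem 1 (proof), as reconstructed in the module docstring] -/
theorem log_pow_three_le_of_le_sq (hK : 1 ≤ K)
    (hP2 : ∀ (ι : Type) [Fintype ι], 0 < Fintype.card ι →
      ∀ ξ : ι → ℚ, (∀ i, ξ i ≠ 0 ∧ ξ i ≠ 1 ∧ ξ i ≠ -1) →
      ∀ ζ : ℚ, (ζ = 1 ∨ ζ = -1) → ∀ b : ι → ℤ, ζ * ∏ i, ξ i ^ b i ≠ 1 →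
      ∀ p : ℕ, p.Prime →
        (padicValRat p (1 - ζ * ∏ i, ξ i ^ b i) : ℝ) * Real.log p <
          K ^ Fintype.card ι * (p / Real.log p) *
            Real.log (max (Real.exp 1) (p * logHeight₁ (ζ * ∏ i, ξ i ^ b i))) *
            ∏ i, logHeight₁ (ξ i))
    {C : ℝ} (hC1 : 1 ≤ C)
    (hC : ∀ S : Finset ℕ, (∀ p ∈ S, p.Prime) → ∏ p ∈ S, 4 * K ^ 2 * Real.log p ^ 2 / p ≤ C)
    (h : IsABCTriple a b c) (hab : a ≤ b) (hca : (c : ℝ) ≤ (a : ℝ) ^ 2) :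
    Real.log c ^ 3 ≤ 64 * K ^ 9 * (2 * C) ^ 3 * max 1 (Real.log (rad a b c : ℕ)) ^ 6 *
      Real.log (max (Real.exp 1) (2 * Real.log c)) ^ 3 * (rad a b c : ℝ) := by
  obtain ⟨ha, hb, habc, hcop⟩ := id h
  have hc : c ≠ 0 := by omega
  have hbc : b.Coprime c := coprime_right_of_isABCTriple h
  have hac : a.Coprime c := coprime_left_of_isABCTriple h
  have habc0 : a * b * c ≠ 0 := by positivity
  -- `a ≥ 2`, hence `ab > 1`
  have ha_r : (0 : ℝ) < a := by exact_mod_cast ha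
  have hb_r : (0 : ℝ) < b := by exact_mod_cast hb
  have hc_r : (0 : ℝ) < c := by exact_mod_cast (Nat.pos_of_ne_zero hc)
  have hac_lt : (a : ℝ) < c := by exact_mod_cast (show a < c by omega)
  have ha2 : 2 ≤ a := by
    by_contra hlt
    have ha1 : a = 1 := by omega
    subst ha1
    norm_num at hca
    have : (2 : ℝ) ≤ c := by exact_mod_cast (show 2 ≤ c by omega)
    linarith
  have h1 : 1 < a * b := by nlinarith
  set y := Real.log c with hy
  set Y := Real.log (max (Real.exp 1) (2 * Real.log c)) with hYdef
  have hy0 : 0 ≤ y := Real.log_nonneg (by exact_mod_cast Nat.one_le_iff_ne_zero.mpr hc)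
  have hY1 : 1 ≤ Y := one_le_log_max_exp _
  have hY0 : 0 ≤ 2 * Y := by linarith
  have hΛ1 : 1 ≤ max 1 (Real.log (rad a b c : ℕ)) := le_max_left _ _
  have hK0 : 0 ≤ K := zero_le_one.trans hK
  -- `y ≤ 2 log a`, `y ≤ 2 log b`
  have hlogsq : ∀ x : ℝ, Real.log (x ^ 2) = 2 * Real.log x := fun x => by
    rw [Real.log_pow]; push_cast; ring
  have hya : y ≤ 2 * Real.log a := by
    rw [← hlogsq]; exact Real.log_le_log hc_r hca
  have hyb : y ≤ 2 * Real.log b := by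
    have hab_r : (a : ℝ) ≤ b := by exact_mod_cast hab
    have hcb : (c : ℝ) ≤ (b : ℝ) ^ 2 := hca.trans (pow_le_pow_left₀ ha_r.le hab_r 2)
    rw [← hlogsq]; exact Real.log_le_log hc_r hcb
  -- the three routes
  have hA0 := log_le_route_a₂ hK hP2 h
  have hB0 := log_le_route_a₂ hK hP2 h.swap
  have hC0 := log_lt_route_c₂ hK hP2 h h1
  have hΘbc : 0 < theta K b c 0 := theta_zero_pos hK hb.ne' hc hbc
  have hΘac : 0 < theta K a c 0 := theta_zero_pos hK ha.ne' hc hac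
  have hΘab : 0 < theta K a b 0 := theta_zero_pos hK ha.ne' hb.ne' hcop
  have hsum0 : ∀ n : ℕ, 0 ≤ ∑ p ∈ n.primeFactors, ((p : ℕ) : ℝ) := fun n =>
    Finset.sum_nonneg fun p _ => Nat.cast_nonneg p
  have hA : y < theta K b c 0 * (2 * Y) * (1 + 3 * ∑ p ∈ a.primeFactors, (p : ℝ)) := by
    have := hsum0 a
    have hpos : 0 < theta K b c 0 * (2 * Y) := by positivity
    nlinarith
  have hB : y < theta K a c 0 * (2 * Y) * (1 + 3 * ∑ p ∈ b.primeFactors, (p : ℝ)) := by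
    have := hsum0 b
    have hpos : 0 < theta K a c 0 * (2 * Y) := by positivity
    nlinarith
  have hCc : y < theta K a b 0 * (2 * Y) * (1 + 3 * ∑ p ∈ c.primeFactors, (p : ℝ)) := by
    have := hsum0 c
    have hpos : 0 < theta K a b 0 * Y * (1 + 3 * ∑ p ∈ c.primeFactors, (p : ℝ)) := by positivity
    nlinarith
  rw [theta_zero_eq_split K hb.ne' hc hbc] at hA
  rw [theta_zero_eq_split K ha.ne' hc hac] at hB
  rw [theta_zero_eq_split K ha.ne' hb.ne' hcop] at hCc
  -- per-member accounting
  have hprime : ∀ n : ℕ, ∀ p ∈ n.primeFactors, p.Prime := fun n p hp =>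
    Nat.prime_of_mem_primeFactors hp
  have hlogle : ∀ {n : ℕ}, n ∣ a * b * c → ∀ p ∈ n.primeFactors,
      Real.log p ≤ max 1 (Real.log (rad a b c : ℕ)) := by
    intro n hn p hp
    have hp' := Nat.prime_of_mem_primeFactors hp
    have hpR : (p : ℝ) ≤ (rad a b c : ℝ) := by
      exact_mod_cast prime_le_rad hp' ((Nat.dvd_of_mem_primeFactors hp).trans hn) habc0
    have hp0 : (0 : ℝ) < p := by exact_mod_cast hp'.pos
    exact (Real.log_le_log hp0 hpR).trans (le_max_right _ _)
  have hXa := member_accounting hK hC1 hC hΛ1 a.primeFactors (hprime a)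
    (hlogle (Dvd.intro (b * c) (by ring)))
  have hXb := member_accounting hK hC1 hC hΛ1 b.primeFactors (hprime b)
    (hlogle (Dvd.intro (a * c) (by ring)))
  have hXc := member_accounting hK hC1 hC hΛ1 c.primeFactors (hprime c)
    (hlogle (Dvd.intro_left (a * b) rfl))
  -- the radical
  have hRprod : ((rad a b c : ℕ) : ℝ) = (∏ p ∈ a.primeFactors, (p : ℝ)) *
      (∏ p ∈ b.primeFactors, (p : ℝ)) * ∏ p ∈ c.primeFactors, (p : ℝ) := by
    rw [rad_def, Nat.radical_eq_prod_primeFactors, Nat.cast_prod,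
      prod_primeFactors_mul_of_coprime (mul_ne_zero ha.ne' hb.ne') hc (Nat.Coprime.mul_left hac hbc),
      prod_primeFactors_mul_of_coprime ha.ne' hb.ne' hcop]
  have key := cube_combine hK0 hy0 hY0 (hsum0 a) (hsum0 b) (hsum0 c) hA hB hCc hXa hXb hXc
  calc Real.log c ^ 3 ≤ _ := key
    _ = 64 * K ^ 9 * (2 * C) ^ 3 * max 1 (Real.log (rad a b c : ℕ)) ^ 6 * Y ^ 3 *
          ((∏ p ∈ a.primeFactors, (p : ℝ)) * (∏ p ∈ b.primeFactors, (p : ℝ)) *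
            ∏ p ∈ c.primeFactors, (p : ℝ)) := by ring
    _ = _ := by rw [hRprod]

/-- **First regime, the bound:** for an abc triple with `a ≤ b` and `c ≤ a²`,
`log c ≤ 64 K³ (2C) (log(32 K³ C) + 3) · R^{1/3} (log R)³` from the `p`-adic clause alone.
[cite: StewartYu2001, Theorem 1 (proof), as reconstructed in the module docstring] -/
theorem log_le_of_le_sq (hK : 1 ≤ K)
    (hP2 : ∀ (ι : Type) [Fintype ι], 0 < Fintype.card ι →
      ∀ ξ : ι → ℚ, (∀ i, ξ i ≠ 0 ∧ ξ i ≠ 1 ∧ ξ i ≠ -1) →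
      ∀ ζ : ℚ, (ζ = 1 ∨ ζ = -1) → ∀ b : ι → ℤ, ζ * ∏ i, ξ i ^ b i ≠ 1 →
      ∀ p : ℕ, p.Prime →
        (padicValRat p (1 - ζ * ∏ i, ξ i ^ b i) : ℝ) * Real.log p <
          K ^ Fintype.card ι * (p / Real.log p) *
            Real.log (max (Real.exp 1) (p * logHeight₁ (ζ * ∏ i, ξ i ^ b i))) *
            ∏ i, logHeight₁ (ξ i))
    {C : ℝ} (hC1 : 1 ≤ C)
    (hC : ∀ S : Finset ℕ, (∀ p ∈ S, p.Prime) → ∏ p ∈ S, 4 * K ^ 2 * Real.log p ^ 2 / p ≤ C)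
    (h : IsABCTriple a b c) (hab : a ≤ b) (hca : (c : ℝ) ≤ (a : ℝ) ^ 2) :
    Real.log c ≤ 64 * K ^ 3 * (2 * C) * (Real.log (16 * K ^ 3 * (2 * C)) + 3) *
      (rad a b c : ℝ) ^ (1 / 3 : ℝ) * Real.log (rad a b c : ℕ) ^ 3 := by
  obtain ⟨ha, hb, habc, hcop⟩ := id h
  have hR2 : (2 : ℝ) ≤ (rad a b c : ℝ) := by
    have : 2 ≤ rad a b c := by
      rw [rad_def, Nat.two_le_radical_iff]
      calc 2 ≤ c := by omega
        _ ≤ a * b * c := Nat.le_mul_of_pos_left c (by positivity)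
    exact_mod_cast this
  have hcube := log_pow_three_le_of_le_sq hK hP2 hC1 hC h hab hca
  have h2C : 1 ≤ 2 * C := by linarith
  have := le_of_cube_le (K := K) hK h2C hR2 hcube
  simpa using this

end RegimeOne


/-! ### Elementary lemmas for the second regime -/

/-- **Self-improvement, quadratic version:** if `M ≥ 1` and `y ≤ M · (log max{e, 2y})²` then
`y ≤ 4M (log(32M))²`. [folklore] -/
theorem le_of_le_mul_log_max_sq {y M : ℝ} (hM : 1 ≤ M)
    (h : y ≤ M * Real.log (max (Real.exp 1) (2 * y)) ^ 2) :
    y ≤ 4 * M * Real.log (32 * M) ^ 2 := by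
  have hM0 : 0 < M := by linarith
  have hlog32 : 1 ≤ Real.log (32 * M) := by
    rw [Real.le_log_iff_exp_le (by positivity)]
    have he : Real.exp 1 < 3 := by
      have := Real.exp_one_lt_d9; linarith
    nlinarith
  by_cases hy : 2 * y ≤ Real.exp 1
  · rw [max_eq_left hy, Real.log_exp, one_pow, mul_one] at h
    calc y ≤ M := h
      _ = 1 * M * 1 := by ring
      _ ≤ 4 * M * Real.log (32 * M) ^ 2 := by
          apply mul_le_mul _ _ zero_le_one (by positivity)
          · linarith
          · nlinarith
  · push Not at hy
    have he1 : (1 : ℝ) < Real.exp 1 := by have := Real.add_one_le_exp (1 : ℝ); linarith [Real.exp_one_gt_d9]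
    have hy0 : 0 < y := by linarith [Real.exp_pos 1]
    rw [max_eq_right hy.le] at h
    set Y := Real.log (2 * y) with hYdef
    have hY1 : 1 < Y := by
      rw [hYdef, Real.lt_log_iff_exp_lt (by linarith)]; exact hy
    -- `Y ≤ 4 (2y)^{1/4}`, so `Y² ≤ 16 (2y)^{1/2}`
    have hYle : Y ≤ 4 * (2 * y) ^ (1 / 4 : ℝ) := by
      have := Real.log_le_rpow_div (show (0 : ℝ) ≤ 2 * y by linarith) (show (0 : ℝ) < 1 / 4 by norm_num)
      rw [hYdef]; linarith [show (2 * y) ^ (1 / 4 : ℝ) / (1 / 4) = 4 * (2 * y) ^ (1 / 4 : ℝ) by ring]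
    have hsq : ((2 * y) ^ (1 / 4 : ℝ)) ^ 2 = (2 * y) ^ (1 / 2 : ℝ) := by
      rw [← Real.rpow_mul_natCast (by linarith)]; norm_num
    have hY2 : Y ^ 2 ≤ 16 * (2 * y) ^ (1 / 2 : ℝ) := by
      calc Y ^ 2 ≤ (4 * (2 * y) ^ (1 / 4 : ℝ)) ^ 2 := pow_le_pow_left₀ (by linarith) hYle 2
        _ = 16 * (2 * y) ^ (1 / 2 : ℝ) := by rw [mul_pow, hsq]; norm_num
    -- hence `y ≤ 16 M (2y)^{1/2}` and `y ≤ 512 M²`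
    have h1 : y ≤ 16 * M * (2 * y) ^ (1 / 2 : ℝ) := by
      calc y ≤ M * Y ^ 2 := h
        _ ≤ M * (16 * (2 * y) ^ (1 / 2 : ℝ)) := mul_le_mul_of_nonneg_left hY2 hM0.le
        _ = 16 * M * (2 * y) ^ (1 / 2 : ℝ) := by ring
    have hhalf : ((2 * y) ^ (1 / 2 : ℝ)) ^ 2 = 2 * y := by
      rw [← Real.rpow_mul_natCast (by linarith)]; norm_num
    have h2 : y ^ 2 ≤ (16 * M) ^ 2 * (2 * y) := by
      calc y ^ 2 ≤ (16 * M * (2 * y) ^ (1 / 2 : ℝ)) ^ 2 := pow_le_pow_left₀ hy0.le h1 2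
        _ = (16 * M) ^ 2 * (2 * y) := by rw [mul_pow, hhalf]
    have h3 : y ≤ 512 * M ^ 2 := by nlinarith
    -- so `Y ≤ 2 log(32M)` and `y ≤ M Y² ≤ 4M log(32M)²`
    have hYle' : Y ≤ 2 * Real.log (32 * M) := by
      rw [hYdef, ← Real.log_rpow (by positivity), Real.rpow_two]
      exact Real.log_le_log (by linarith) (by nlinarith)
    have hY0 : 0 ≤ Y := by linarith
    calc y ≤ M * Y ^ 2 := h
      _ ≤ M * (2 * Real.log (32 * M)) ^ 2 :=
          mul_le_mul_of_nonneg_left (pow_le_pow_left₀ hY0 hYle' 2) hM0.le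
      _ = 4 * M * Real.log (32 * M) ^ 2 := by ring

/-- **Endgame of the second regime** (pure analysis): if `R ≥ 2`, `M₀ ≥ 1` and
`y ≤ M₀ R^{7/24} Λ³ Y²` with `Λ = max(1, log R)`, `Y = log max{e, 2y}`, then
`y ≤ 73728 M₀ (log(32M₀) + 4)² · R^{1/3} (log R)³`. [folklore] -/
theorem regimeII_endgame {y R M₀ : ℝ} (hM₀ : 1 ≤ M₀) (hR : 2 ≤ R)
    (h : y ≤ M₀ * R ^ (7 / 24 : ℝ) * max 1 (Real.log R) ^ 3 *
      Real.log (max (Real.exp 1) (2 * y)) ^ 2) :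
    y ≤ 73728 * M₀ * (Real.log (32 * M₀) + 4) ^ 2 * R ^ (1 / 3 : ℝ) * Real.log R ^ 3 := by
  set L : ℝ := Real.log R with hL
  set Λ : ℝ := max 1 L
  set M : ℝ := M₀ * R ^ (7 / 24 : ℝ) * Λ ^ 3 with hM
  set c₀ : ℝ := Real.log (32 * M₀) with hc₀
  have hR0 : 0 < R := by linarith
  have hR1 : 1 ≤ R := by linarith
  have hΛ1 : 1 ≤ Λ := le_max_left _ _
  have hΛ0 : 0 < Λ := by linarith
  have hR724 : 1 ≤ R ^ (7 / 24 : ℝ) := Real.one_le_rpow hR1 (by norm_num)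
  have hM1 : 1 ≤ M := by
    calc (1 : ℝ) = 1 * 1 * 1 := by ring
      _ ≤ M₀ * R ^ (7 / 24 : ℝ) * Λ ^ 3 :=
          mul_le_mul (mul_le_mul hM₀ hR724 zero_le_one (by linarith)) (one_le_pow₀ hΛ1)
            zero_le_one (by positivity)
  have h1 : y ≤ 4 * M * Real.log (32 * M) ^ 2 := le_of_le_mul_log_max_sq hM1 (by rw [hM]; linarith)
  -- `log(32M) ≤ (c₀ + 4) Λ`
  have hc₀1 : 1 ≤ c₀ := by
    rw [hc₀, Real.le_log_iff_exp_le (by positivity)]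
    have := Real.exp_one_lt_d9; nlinarith
  have hlogM : Real.log (32 * M) ≤ (c₀ + 4) * Λ := by
    have hsplit : 32 * M = (32 * M₀) * (R ^ (7 / 24 : ℝ) * Λ ^ 3) := by rw [hM]; ring
    have hexp : Real.log (32 * M) = c₀ + 7 / 24 * L + 3 * Real.log Λ := by
      rw [hsplit, Real.log_mul (by positivity) (by positivity),
        Real.log_mul (x := R ^ (7 / 24 : ℝ)) (y := Λ ^ 3) (by positivity) (by positivity),
        Real.log_rpow hR0, Real.log_pow, hc₀]
      push_cast; ring
    have hlogΛ : Real.log Λ ≤ Λ := Real.log_le_self hΛ0.le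
    have hLΛ : L ≤ Λ := le_max_right _ _
    have hc₀Λ : c₀ ≤ c₀ * Λ := le_mul_of_one_le_right (by linarith) hΛ1
    rw [hexp]; nlinarith
  -- `Λ ≤ 48 R^{1/48}` and `Λ ≤ 2 L`
  have hΛ48 : Λ ≤ 48 * R ^ (1 / 48 : ℝ) := by
    refine max_le ?_ ?_
    · have : 1 ≤ R ^ (1 / 48 : ℝ) := Real.one_le_rpow hR1 (by norm_num)
      linarith
    · have := Real.log_le_rpow_div hR0.le (show (0 : ℝ) < 1 / 48 by norm_num)
      rw [hL]; linarith [show R ^ (1 / 48 : ℝ) / (1 / 48) = 48 * R ^ (1 / 48 : ℝ) by ring]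
  have hL2 : Real.log 2 ≤ L := Real.log_le_log two_pos hR
  have hlog2 : (1 / 2 : ℝ) ≤ Real.log 2 := by have := Real.log_two_gt_d9; linarith
  have hL0 : 0 ≤ L := by linarith
  have hΛL : Λ ≤ 2 * L := max_le (by linarith) (by linarith)
  have hΛ2 : Λ ^ 2 ≤ 2304 * R ^ (1 / 24 : ℝ) := by
    have hsq : (R ^ (1 / 48 : ℝ)) ^ 2 = R ^ (1 / 24 : ℝ) := by
      rw [← Real.rpow_mul_natCast hR0.le]; norm_num
    calc Λ ^ 2 ≤ (48 * R ^ (1 / 48 : ℝ)) ^ 2 := pow_le_pow_left₀ hΛ0.le hΛ48 2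
      _ = 2304 * R ^ (1 / 24 : ℝ) := by rw [mul_pow, hsq]; norm_num
  have hΛ3 : Λ ^ 3 ≤ 8 * L ^ 3 := by
    calc Λ ^ 3 ≤ (2 * L) ^ 3 := pow_le_pow_left₀ hΛ0.le hΛL 3
      _ = 8 * L ^ 3 := by ring
  have hRR : R ^ (7 / 24 : ℝ) * R ^ (1 / 24 : ℝ) = R ^ (1 / 3 : ℝ) := by
    rw [← Real.rpow_add hR0]; norm_num
  -- assemble
  have hc4 : 0 ≤ c₀ + 4 := by linarith
  calc y ≤ 4 * M * Real.log (32 * M) ^ 2 := h1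
    _ ≤ 4 * M * ((c₀ + 4) * Λ) ^ 2 := by
        apply mul_le_mul_of_nonneg_left _ (by positivity)
        exact pow_le_pow_left₀ (by linarith [Real.log_nonneg (show (1:ℝ) ≤ 32 * M by linarith)]) hlogM 2
    _ = 4 * M₀ * (c₀ + 4) ^ 2 * R ^ (7 / 24 : ℝ) * Λ ^ 3 * Λ ^ 2 := by rw [hM]; ring
    _ ≤ 4 * M₀ * (c₀ + 4) ^ 2 * R ^ (7 / 24 : ℝ) * (8 * L ^ 3) * (2304 * R ^ (1 / 24 : ℝ)) := by
        apply mul_le_mul _ hΛ2 (by positivity) (by positivity)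
        exact mul_le_mul_of_nonneg_left hΛ3 (by positivity)
    _ = 73728 * M₀ * (c₀ + 4) ^ 2 * (R ^ (7 / 24 : ℝ) * R ^ (1 / 24 : ℝ)) * L ^ 3 := by ring
    _ = 73728 * M₀ * (c₀ + 4) ^ 2 * R ^ (1 / 3 : ℝ) * L ^ 3 := by rw [hRR]

/-- **Primes beat `2K max(1, log p)` at exponent `1/48`.** For `K ≥ 0` there is `C₁ ≥ 1` with
`∏_{p ∈ S} 2K max(1, log p) ≤ C₁ · (∏_{p ∈ S} p)^{1/48}` for every finite set `S` of primes.
[folklore] -/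
theorem exists_prod_two_mul_max_log_le {K : ℝ} (hK : 0 ≤ K) :
    ∃ C₁ : ℝ, 1 ≤ C₁ ∧ ∀ S : Finset ℕ, (∀ p ∈ S, p.Prime) →
      ∏ p ∈ S, 2 * K * max 1 (Real.log p) ≤ C₁ * (∏ p ∈ S, (p : ℝ)) ^ (1 / 48 : ℝ) := by
  classical
  set N : ℕ := ⌈(192 * K) ^ (96 : ℕ)⌉₊ + 3 with hN
  set f : ℕ → ℝ := fun p => 2 * K * max 1 (Real.log p) / (p : ℝ) ^ (1 / 48 : ℝ) with hf
  set C₁ : ℝ := ∏ p ∈ (Finset.range N).filter Nat.Prime, max 1 (f p) with hC₁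
  have hC₁1 : 1 ≤ C₁ := Finset.one_le_prod fun p _ => le_max_left _ _
  refine ⟨C₁, hC₁1, fun S hS => ?_⟩
  have hp0 : ∀ p ∈ S, (0 : ℝ) < p := fun p hp => by exact_mod_cast (hS p hp).pos
  have hf0 : ∀ p ∈ S, 0 ≤ f p := fun p hp => by
    have := hp0 p hp
    have : (0 : ℝ) ≤ max 1 (Real.log p) := zero_le_one.trans (le_max_left _ _)
    positivity
  -- rewrite the product as `(∏ f) · (∏ p)^{1/48}`
  have hsplit : ∏ p ∈ S, 2 * K * max 1 (Real.log p) =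
      (∏ p ∈ S, f p) * (∏ p ∈ S, (p : ℝ)) ^ (1 / 48 : ℝ) := by
    rw [← Real.finsetProd_rpow S (fun p => ((p : ℕ) : ℝ)) (fun p hp => (hp0 p hp).le),
      ← Finset.prod_mul_distrib]
    refine Finset.prod_congr rfl fun p hp => ?_
    have : (0 : ℝ) < (p : ℝ) ^ (1 / 48 : ℝ) := Real.rpow_pos_of_pos (hp0 p hp) _
    rw [hf]; dsimp only; rw [div_mul_cancel₀ _ this.ne']
  rw [hsplit]
  refine mul_le_mul_of_nonneg_right ?_ (by positivity)
  -- split `S` at `N`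
  rw [← Finset.prod_filter_mul_prod_filter_not S (fun p => p < N)]
  have hsmall : ∏ p ∈ S.filter (fun p => p < N), f p ≤ C₁ := by
    calc ∏ p ∈ S.filter (fun p => p < N), f p
        ≤ ∏ p ∈ S.filter (fun p => p < N), max 1 (f p) :=
          Finset.prod_le_prod (fun p hp => hf0 p (Finset.mem_filter.mp hp).1)
            fun p _ => le_max_right _ _
      _ ≤ C₁ := by
          apply Finset.prod_le_prod_of_subset_of_one_le
          · intro p hp
            obtain ⟨hpS, hpN⟩ := Finset.mem_filter.mp hp
            exact Finset.mem_filter.mpr ⟨Finset.mem_range.mpr hpN, hS p hpS⟩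
          · intro p _; exact zero_le_one.trans (le_max_left _ _)
          · intro p _ _; exact le_max_left _ _
  have hlarge : ∏ p ∈ S.filter (fun p => ¬p < N), f p ≤ 1 := by
    refine Finset.prod_le_one (fun p hp => hf0 p (Finset.mem_filter.mp hp).1) fun p hp => ?_
    obtain ⟨hpS, hpN⟩ := Finset.mem_filter.mp hp
    push Not at hpN
    have hp := hS p hpS
    have hp3 : (3 : ℝ) ≤ p := by exact_mod_cast le_trans (by omega) hpN
    have hpr : (0 : ℝ) < p := hp0 p hpS
    have hpN' : (192 * K) ^ (96 : ℕ) ≤ (p : ℝ) := by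
      have h1 : ((⌈(192 * K) ^ (96 : ℕ)⌉₊ : ℕ) : ℝ) ≤ p := by exact_mod_cast le_trans (Nat.le_add_right _ _) hpN
      exact (Nat.le_ceil _).trans h1
    -- `max 1 (log p) = log p` and `2K log p ≤ 192 K p^{1/96} ≤ p^{1/48}`
    have hlogp1 : 1 ≤ Real.log p := by
      rw [Real.le_log_iff_exp_le hpr]
      have := Real.exp_one_lt_d9; linarith
    have hmax : max 1 (Real.log p) = Real.log p := max_eq_right hlogp1
    have hroot : 192 * K ≤ (p : ℝ) ^ (1 / 96 : ℝ) := by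
      have h192 : 0 ≤ 192 * K := by positivity
      calc 192 * K = ((192 * K) ^ (96 : ℕ)) ^ (1 / 96 : ℝ) := by
            rw [← Real.rpow_natCast, ← Real.rpow_mul h192]; norm_num
        _ ≤ (p : ℝ) ^ (1 / 96 : ℝ) := Real.rpow_le_rpow (by positivity) hpN' (by norm_num)
    have hlog96 : Real.log p ≤ 96 * (p : ℝ) ^ (1 / 96 : ℝ) := by
      have := Real.log_le_rpow_div hpr.le (show (0 : ℝ) < 1 / 96 by norm_num)
      linarith [show (p : ℝ) ^ (1 / 96 : ℝ) / (1 / 96) = 96 * (p : ℝ) ^ (1 / 96 : ℝ) by ring]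
    have hsq : (p : ℝ) ^ (1 / 96 : ℝ) * (p : ℝ) ^ (1 / 96 : ℝ) = (p : ℝ) ^ (1 / 48 : ℝ) := by
      rw [← Real.rpow_add hpr]; norm_num
    have hp96 : 0 ≤ (p : ℝ) ^ (1 / 96 : ℝ) := Real.rpow_nonneg hpr.le _
    have key : 2 * K * Real.log p ≤ (p : ℝ) ^ (1 / 48 : ℝ) := by
      calc 2 * K * Real.log p ≤ 2 * K * (96 * (p : ℝ) ^ (1 / 96 : ℝ)) :=
            mul_le_mul_of_nonneg_left hlog96 (by positivity)
        _ = (192 * K) * (p : ℝ) ^ (1 / 96 : ℝ) := by ring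
        _ ≤ (p : ℝ) ^ (1 / 96 : ℝ) * (p : ℝ) ^ (1 / 96 : ℝ) := mul_le_mul_of_nonneg_right hroot hp96
        _ = (p : ℝ) ^ (1 / 48 : ℝ) := hsq
    have hp48 : 0 < (p : ℝ) ^ (1 / 48 : ℝ) := Real.rpow_pos_of_pos hpr _
    rw [hf]; dsimp only
    rw [hmax, div_le_one hp48]
    exact key
  have h0 : 0 ≤ ∏ p ∈ S.filter (fun p => ¬p < N), f p :=
    Finset.prod_nonneg fun p hp => hf0 p (Finset.mem_filter.mp hp).1
  calc (∏ p ∈ S.filter (fun p => p < N), f p) * ∏ p ∈ S.filter (fun p => ¬p < N), f p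
      ≤ C₁ * 1 := mul_le_mul hsmall hlarge h0 (zero_le_one.trans hC₁1)
    _ = C₁ := mul_one C₁

/-- **At most three primes above `R^{1/4}`.** If `L` is a finite set of naturals whose product
divides `R ≠ 0` and each of which exceeds `R^{1/4}`, then `#L ≤ 3`. [folklore] -/
theorem card_le_three_of_quarter_lt {R : ℕ} (hR : R ≠ 0) (L : Finset ℕ)
    (hdvd : ∏ q ∈ L, q ∣ R) (hbig : ∀ q ∈ L, (R : ℝ) ^ (1 / 4 : ℝ) < q) : L.card ≤ 3 := by
  by_contra hcon
  push Not at hcon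
  have hR0 : (0 : ℝ) ≤ R := Nat.cast_nonneg R
  -- each `q ∈ L` has `q⁴ ≥ R + 1`
  have hq4 : ∀ q ∈ L, R + 1 ≤ q ^ 4 := by
    intro q hq
    have h1 : ((R : ℝ) ^ (1 / 4 : ℝ)) ^ 4 = R := by
      rw [← Real.rpow_mul_natCast hR0]; norm_num
    have h2 : (R : ℝ) < (q : ℝ) ^ 4 := by
      rw [← h1]
      exact pow_lt_pow_left₀ (hbig q hq) (Real.rpow_nonneg hR0 _) (by norm_num)
    exact_mod_cast h2
  have hprod : (R + 1) ^ L.card ≤ ∏ q ∈ L, q ^ 4 := Finset.pow_card_le_prod L (fun q => q ^ 4) _ hq4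
  rw [Finset.prod_pow] at hprod
  have hle : ∏ q ∈ L, q ≤ R := Nat.le_of_dvd (Nat.pos_of_ne_zero hR) hdvd
  have h4 : (∏ q ∈ L, q) ^ 4 ≤ R ^ 4 := Nat.pow_le_pow_left hle 4
  have h5 : (R + 1) ^ 4 ≤ (R + 1) ^ L.card := Nat.pow_le_pow_right (Nat.succ_pos R) hcon
  have h6 : R ^ 4 < (R + 1) ^ 4 := Nat.pow_lt_pow_left (Nat.lt_succ_self R) (by norm_num)
  omega


/-! ### The archimedean lower bound with an arbitrary constant, applied to few generators -/

section Arch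

variable (C : ℕ → ℝ)

/-- `0.16 ≤ log 2`. [folklore] -/
theorem d16_le_log_two : (0.16 : ℝ) ≤ Real.log 2 := by
  have := Real.log_two_gt_d9; linarith

/-- **The archimedean bound for `Λ = log β + ∑_{p ∈ T} e_p log p`, `β ≠ 1`** (`β > 0` rational,
`T` a nonempty set of at most three primes, `|e_p| ≤ E`, `E ≥ 1`), from a lower bound for linear
forms in `2 ≤ n ≤ 4` logarithms of positive rationals with ANY constant `C(n)`:
`log |Λ| > −C(#T+1) · (∏_{p ∈ T} log p) · max(1, h(β)) · log(eE)`. [folklore] -/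
theorem arch_lower_bound_beta
    (hA : ∀ (κ : Type) [Fintype κ], 2 ≤ Fintype.card κ → Fintype.card κ ≤ 4 →
      ∀ (α : κ → ℚ) (b : κ → ℤ) (A : κ → ℝ) (B : ℝ),
        (∀ k, 0 < α k ∧ α k ≠ 1) → b ≠ 0 →
        ∑ k, (b k : ℝ) * Real.log (α k : ℝ) ≠ 0 →
        (∀ k, max (logHeight₁ (α k)) (max |Real.log (α k : ℝ)| 0.16) ≤ A k) →
        1 ≤ B → (∀ k, (|b k| : ℝ) ≤ B) →
        -(C (Fintype.card κ) * (∏ k, A k) * Real.log (Real.exp 1 * B)) <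
          Real.log |∑ k, (b k : ℝ) * Real.log (α k : ℝ)|)
    (T : Finset ℕ) (hT : ∀ p ∈ T, p.Prime) (hTne : T.Nonempty) (hT3 : T.card ≤ 3) (e : ℕ → ℤ)
    {β : ℚ} (hβ0 : 0 < β) (hβ1 : β ≠ 1) {E : ℝ} (hE1 : 1 ≤ E) (hE : ∀ p ∈ T, (|e p| : ℝ) ≤ E)
    (hΛ : Real.log (β : ℝ) + ∑ p ∈ T, (e p : ℝ) * Real.log p ≠ 0) :
    -(C (T.card + 1) * ((∏ p ∈ T, Real.log p) * max 1 (logHeight₁ β)) *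
        Real.log (Real.exp 1 * E)) <
      Real.log |Real.log (β : ℝ) + ∑ p ∈ T, (e p : ℝ) * Real.log p| := by
  classical
  have hcard : Fintype.card (Option T) = T.card + 1 := by
    rw [Fintype.card_option, Fintype.card_coe]
  have hcard2 : 2 ≤ Fintype.card (Option T) := by
    rw [hcard]; have := hTne.card_pos; omega
  have hcard4 : Fintype.card (Option T) ≤ 4 := by rw [hcard]; omega
  set α : Option T → ℚ := fun o => o.elim β fun i => ((i : ℕ) : ℚ) with hα
  set b : Option T → ℤ := fun o => o.elim 1 fun i => e i with hb
  set A : Option T → ℝ := fun o => o.elim (max 1 (logHeight₁ β)) fun i => Real.log ((i : ℕ) : ℝ)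
    with hAdef
  have hgen : ∀ o, 0 < α o ∧ α o ≠ 1 := by
    rintro (_ | i)
    · exact ⟨hβ0, hβ1⟩
    · have hp := hT i i.2
      exact ⟨by simp only [hα, Option.elim]; exact_mod_cast hp.pos,
        by simp only [hα, Option.elim]; exact_mod_cast hp.one_lt.ne'⟩
  have hb0 : b ≠ 0 := by
    intro h
    have := congrFun h none
    simp [hb] at this
  have hsum : ∑ o, (b o : ℝ) * Real.log (α o : ℝ) =
      Real.log (β : ℝ) + ∑ p ∈ T, (e p : ℝ) * Real.log p := by
    rw [Fintype.sum_option]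
    simp only [hα, hb, Option.elim, Int.cast_one, one_mul, Rat.cast_natCast]
    rw [Finset.sum_coe_sort T fun p => (e p : ℝ) * Real.log p]
  have hprod : ∏ o, A o = max 1 (logHeight₁ β) * ∏ p ∈ T, Real.log p := by
    rw [Fintype.prod_option]
    simp only [hAdef, Option.elim]
    rw [Finset.prod_coe_sort T fun p => Real.log (p : ℝ)]
  have hAk : ∀ o, max (logHeight₁ (α o)) (max |Real.log (α o : ℝ)| 0.16) ≤ A o := by
    rintro (_ | i)
    · simp only [hα, hAdef, Option.elim]
      refine max_le (le_max_right _ _) (max_le ?_ ?_)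
      · have h := abs_log_abs_le_logHeight₁ hβ0.ne'
        rw [abs_of_pos (show (0 : ℝ) < (β : ℝ) by exact_mod_cast hβ0)] at h
        exact h.trans (le_max_right _ _)
      · norm_num
    · have hp := hT i i.2
      haveI : NeZero (i : ℕ) := ⟨hp.ne_zero⟩
      have hlog2 : Real.log 2 ≤ Real.log ((i : ℕ) : ℝ) :=
        Real.log_le_log two_pos (by exact_mod_cast hp.two_le)
      have hlog0 : 0 ≤ Real.log ((i : ℕ) : ℝ) := le_trans (by linarith [d16_le_log_two]) hlog2
      simp only [hα, hAdef, Option.elim, Rat.cast_natCast]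
      refine max_le (by rw [Rat.logHeight₁_natCast]) (max_le (by rw [abs_of_nonneg hlog0]) ?_)
      linarith [d16_le_log_two]
  have hbB : ∀ o, (|b o| : ℝ) ≤ E := by
    rintro (_ | i)
    · simp only [hb, Option.elim, Int.cast_one, abs_one]; exact hE1
    · exact hE i i.2
  have key := hA (Option T) hcard2 hcard4 α b A E hgen hb0 (by rw [hsum]; exact hΛ) hAk hE1 hbB
  rw [hsum, hprod, hcard] at key
  convert key using 2; ring

/-- **The archimedean bound for `Λ = ∑_{p ∈ T} e_p log p`** (`T` a set of two to four primes,
`|e_p| ≤ E`, `E ≥ 1`), from a lower bound with ANY constant `C(n)`: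
`log |Λ| > −C(#T) · (∏_{p ∈ T} log p) · log(eE)`. [folklore] -/
theorem arch_lower_bound_one
    (hA : ∀ (κ : Type) [Fintype κ], 2 ≤ Fintype.card κ → Fintype.card κ ≤ 4 →
      ∀ (α : κ → ℚ) (b : κ → ℤ) (A : κ → ℝ) (B : ℝ),
        (∀ k, 0 < α k ∧ α k ≠ 1) → b ≠ 0 →
        ∑ k, (b k : ℝ) * Real.log (α k : ℝ) ≠ 0 →
        (∀ k, max (logHeight₁ (α k)) (max |Real.log (α k : ℝ)| 0.16) ≤ A k) →
        1 ≤ B → (∀ k, (|b k| : ℝ) ≤ B) →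
        -(C (Fintype.card κ) * (∏ k, A k) * Real.log (Real.exp 1 * B)) <
          Real.log |∑ k, (b k : ℝ) * Real.log (α k : ℝ)|)
    (T : Finset ℕ) (hT : ∀ p ∈ T, p.Prime) (hT2 : 2 ≤ T.card) (hT4 : T.card ≤ 4) (e : ℕ → ℤ)
    {E : ℝ} (hE1 : 1 ≤ E) (hE : ∀ p ∈ T, (|e p| : ℝ) ≤ E)
    (hΛ : ∑ p ∈ T, (e p : ℝ) * Real.log p ≠ 0) :
    -(C T.card * (∏ p ∈ T, Real.log p) * Real.log (Real.exp 1 * E)) <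
      Real.log |∑ p ∈ T, (e p : ℝ) * Real.log p| := by
  classical
  have hcard : Fintype.card T = T.card := Fintype.card_coe T
  set α : T → ℚ := fun i => ((i : ℕ) : ℚ) with hα
  set b : T → ℤ := fun i => e i with hb
  set A : T → ℝ := fun i => Real.log ((i : ℕ) : ℝ) with hAdef
  have hgen : ∀ i, 0 < α i ∧ α i ≠ 1 := fun i => by
    have hp := hT i i.2
    exact ⟨by simp only [hα]; exact_mod_cast hp.pos, by simp only [hα]; exact_mod_cast hp.one_lt.ne'⟩
  have hsum : ∑ i, (b i : ℝ) * Real.log (α i : ℝ) = ∑ p ∈ T, (e p : ℝ) * Real.log p := by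
    simp only [hα, hb, Rat.cast_natCast]
    exact Finset.sum_coe_sort T fun p => (e p : ℝ) * Real.log p
  have hprod : ∏ i, A i = ∏ p ∈ T, Real.log p := by
    simp only [hAdef]
    exact Finset.prod_coe_sort T fun p => Real.log (p : ℝ)
  have hb0 : b ≠ 0 := by
    intro h
    apply hΛ
    rw [← hsum]
    simp [h]
  have hAk : ∀ i, max (logHeight₁ (α i)) (max |Real.log (α i : ℝ)| 0.16) ≤ A i := fun i => by
    have hp := hT i i.2
    haveI : NeZero (i : ℕ) := ⟨hp.ne_zero⟩
    have hlog2 : Real.log 2 ≤ Real.log ((i : ℕ) : ℝ) :=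
      Real.log_le_log two_pos (by exact_mod_cast hp.two_le)
    have hlog0 : 0 ≤ Real.log ((i : ℕ) : ℝ) := le_trans (by linarith [d16_le_log_two]) hlog2
    simp only [hα, hAdef, Rat.cast_natCast]
    refine max_le (by rw [Rat.logHeight₁_natCast]) (max_le (by rw [abs_of_nonneg hlog0]) ?_)
    linarith [d16_le_log_two]
  have hbB : ∀ i, (|b i| : ℝ) ≤ E := fun i => hE i i.2
  have key := hA T (by rw [hcard]; exact hT2) (by rw [hcard]; exact hT4) α b A E hgen hb0
    (by rw [hsum]; exact hΛ) hAk hE1 hbB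
  rwa [hsum, hprod, hcard] at key

/-- From the REFINED shape of the archimedean bound (Evertse–Győry's Theorem 3.2.4 over `ℚ`:
`B ≥ max{1, maxₖ |bₖ| Aₖ / A_{k₀}}` for a chosen `k₀`, as in the hypothesis `hM` of
`Dioph.thm328_rat_infinite_of_archBound`) to the CRUDE shape used in this file
(`B ≥ max{1, maxₖ |bₖ|}`, and only `2 ≤ n ≤ 4` generators): take `k₀` with `A_{k₀}` maximal. [cite: EvertseGyory2015, Thm 3.2.4 (p. 61)] -/
theorem archBound_crude_of_refined
    (hM : ∀ (κ : Type) [Fintype κ], 2 ≤ Fintype.card κ →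
      ∀ (α : κ → ℚ) (b : κ → ℤ) (A : κ → ℝ) (k₀ : κ) (B : ℝ),
        (∀ k, 0 < α k ∧ α k ≠ 1) → b ≠ 0 →
        ∑ k, (b k : ℝ) * Real.log (α k : ℝ) ≠ 0 →
        (∀ k, max (logHeight₁ (α k)) (max |Real.log (α k : ℝ)| 0.16) ≤ A k) →
        1 ≤ B → (∀ k, (|b k| : ℝ) * A k / A k₀ ≤ B) →
        -(C (Fintype.card κ) * (∏ k, A k) * Real.log (Real.exp 1 * B)) <
          Real.log |∑ k, (b k : ℝ) * Real.log (α k : ℝ)|) :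
    ∀ (κ : Type) [Fintype κ], 2 ≤ Fintype.card κ → Fintype.card κ ≤ 4 →
      ∀ (α : κ → ℚ) (b : κ → ℤ) (A : κ → ℝ) (B : ℝ),
        (∀ k, 0 < α k ∧ α k ≠ 1) → b ≠ 0 →
        ∑ k, (b k : ℝ) * Real.log (α k : ℝ) ≠ 0 →
        (∀ k, max (logHeight₁ (α k)) (max |Real.log (α k : ℝ)| 0.16) ≤ A k) →
        1 ≤ B → (∀ k, (|b k| : ℝ) ≤ B) →
        -(C (Fintype.card κ) * (∏ k, A k) * Real.log (Real.exp 1 * B)) <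
          Real.log |∑ k, (b k : ℝ) * Real.log (α k : ℝ)| := by
  intro κ _ hκ _ α b A B hα hb hS hAk hB1 hbB
  have hne : (Finset.univ : Finset κ).Nonempty := by
    rw [Finset.univ_nonempty_iff, ← Fintype.card_pos_iff]; omega
  obtain ⟨k₀, -, hk₀⟩ := Finset.exists_max_image Finset.univ A hne
  have hApos : ∀ k, 0 < A k := fun k =>
    lt_of_lt_of_le (by norm_num) ((le_max_right _ _).trans ((le_max_right _ _).trans (hAk k)))
  refine hM κ hκ α b A k₀ B hα hb hS hAk hB1 fun k => ?_
  have h1 : A k / A k₀ ≤ 1 := (div_le_one (hApos k₀)).mpr (hk₀ k (Finset.mem_univ k))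
  calc (|b k| : ℝ) * A k / A k₀ = (|b k| : ℝ) * (A k / A k₀) := by ring
    _ ≤ (|b k| : ℝ) * 1 := mul_le_mul_of_nonneg_left h1 (abs_nonneg _)
    _ = (|b k| : ℝ) := mul_one _
    _ ≤ B := hbB k

end Arch


/-! ### Second regime: `a² < c` (with `a ≤ b`) — few large primes at the archimedean place -/

section RegimeTwo

variable {K : ℝ} {a b c : ℕ}

/-- `Θ_{u,v} ≤ K · J` at threshold `0`, where `J = ∏_{q ∣ n} 2K max(1, log q)` for any multiple
`n` of `uv` (`K ≥ 1`). [folklore] -/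
theorem theta_zero_le_mul_prod (hK : 1 ≤ K) {u v n : ℕ} (hu : u ≠ 0) (hv : v ≠ 0)
    (huv : u.Coprime v) (hn : n ≠ 0) (hdvd : u * v ∣ n) :
    theta K u v 0 ≤ K * ∏ q ∈ n.primeFactors, 2 * K * max 1 (Real.log q) := by
  have hK0 : 0 ≤ K := zero_le_one.trans hK
  rw [theta_zero_eq K hu hv huv, pow_succ, mul_comm (K ^ _) K, mul_assoc]
  refine mul_le_mul_of_nonneg_left ?_ hK0
  have hlog0 : ∀ q ∈ (u * v).primeFactors, 0 ≤ Real.log q := fun q hq =>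
    Real.log_nonneg (by exact_mod_cast (Nat.prime_of_mem_primeFactors hq).one_lt.le)
  calc K ^ (u * v).primeFactors.card * ∏ q ∈ (u * v).primeFactors, Real.log q
      = ∏ q ∈ (u * v).primeFactors, K * Real.log q := by
        rw [Finset.prod_mul_distrib, Finset.prod_const]
    _ ≤ ∏ q ∈ (u * v).primeFactors, 2 * K * max 1 (Real.log q) := by
        refine Finset.prod_le_prod (fun q hq => mul_nonneg hK0 (hlog0 q hq)) fun q hq => ?_
        have h1 : Real.log q ≤ max 1 (Real.log q) := le_max_right _ _
        have h2 : (0 : ℝ) ≤ max 1 (Real.log q) := zero_le_one.trans (le_max_left _ _)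
        nlinarith
    _ ≤ ∏ q ∈ n.primeFactors, 2 * K * max 1 (Real.log q) := by
        apply Finset.prod_le_prod_of_subset_of_one_le (Nat.primeFactors_mono hdvd hn)
        · intro q _
          have : (0 : ℝ) ≤ max 1 (Real.log q) := zero_le_one.trans (le_max_left _ _)
          positivity
        · intro q _ _
          have : (1 : ℝ) ≤ max 1 (Real.log q) := le_max_left _ _
          nlinarith

/-- `ω(n) ≤ J = ∏_{q ∣ n} 2K max(1, log q)` (`K ≥ 1`; each factor is `≥ 2`). [folklore] -/
theorem card_primeFactors_le_prod (hK : 1 ≤ K) (n : ℕ) :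
    ((n.primeFactors.card : ℕ) : ℝ) ≤ ∏ q ∈ n.primeFactors, 2 * K * max 1 (Real.log q) := by
  have h1 : ((n.primeFactors.card : ℕ) : ℝ) ≤ 2 ^ n.primeFactors.card := by
    exact_mod_cast (Nat.lt_two_pow_self).le
  refine h1.trans ?_
  rw [← Finset.prod_const]
  refine Finset.prod_le_prod (fun _ _ => by norm_num) fun q _ => ?_
  have : (1 : ℝ) ≤ max 1 (Real.log q) := le_max_left _ _
  nlinarith

/-- `1 ≤ J`. [folklore] -/
theorem one_le_prod_two_mul_max (hK : 1 ≤ K) (n : ℕ) :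
    (1 : ℝ) ≤ ∏ q ∈ n.primeFactors, 2 * K * max 1 (Real.log q) := by
  refine Finset.one_le_prod fun q _ => ?_
  have : (1 : ℝ) ≤ max 1 (Real.log q) := le_max_left _ _
  nlinarith

/-- `ν_p(n) ≤ (3/2) log n` for `n ≠ 0` and a prime `p` (`p^{ν} ≤ n`, `log p ≥ log 2 > 2/3`).
[folklore] -/
theorem factorization_le_log {n p : ℕ} (hn : n ≠ 0) (hp : p.Prime) :
    (n.factorization p : ℝ) ≤ 3 / 2 * Real.log n := by
  have h1 : ((p ^ n.factorization p : ℕ) : ℝ) ≤ n := by exact_mod_cast Nat.ordProj_le p hn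
  have hp2 : (2 : ℝ) ≤ p := by exact_mod_cast hp.two_le
  have hlog2 : (2 / 3 : ℝ) ≤ Real.log p := by
    have := Real.log_two_gt_d9
    have := Real.log_le_log two_pos hp2
    linarith
  have h2 : (n.factorization p : ℝ) * Real.log p ≤ Real.log n := by
    rw [← Real.log_pow]
    exact Real.log_le_log (by positivity) (by exact_mod_cast h1)
  have h0 : (0 : ℝ) ≤ n.factorization p := Nat.cast_nonneg _
  nlinarith

/-- **Height of the smooth part.** For an abc triple with `ab > 1`, a set `S` of primes of `cb`
all `≤ τ`, and `β = ∏_{q ∈ S} q^{e_q}` (`e_q = ν_q(c) − ν_q(b)`):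
`h(β) ≤ #S · (Θ_{ab} + Θ_{ac}) · 3τY`, `Y = log max{e, 2 log c}` — every exponent is paid for by
the `p`-adic clause at the (small) prime `q`. [cite: StewartYu2001, Theorem 1 (proof), as reconstructed] -/
theorem logHeight₁_smooth_le (hK : 1 ≤ K)
    (hP2 : ∀ (ι : Type) [Fintype ι], 0 < Fintype.card ι →
      ∀ ξ : ι → ℚ, (∀ i, ξ i ≠ 0 ∧ ξ i ≠ 1 ∧ ξ i ≠ -1) →
      ∀ ζ : ℚ, (ζ = 1 ∨ ζ = -1) → ∀ b : ι → ℤ, ζ * ∏ i, ξ i ^ b i ≠ 1 →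
      ∀ p : ℕ, p.Prime →
        (padicValRat p (1 - ζ * ∏ i, ξ i ^ b i) : ℝ) * Real.log p <
          K ^ Fintype.card ι * (p / Real.log p) *
            Real.log (max (Real.exp 1) (p * logHeight₁ (ζ * ∏ i, ξ i ^ b i))) *
            ∏ i, logHeight₁ (ξ i))
    (h : IsABCTriple a b c) (h1 : 1 < a * b) (S : Finset ℕ) (hS : S ⊆ (c * b).primeFactors)
    {τ : ℝ} (hSτ : ∀ q ∈ S, (q : ℝ) ≤ τ) :
    logHeight₁ (∏ q ∈ S, (q : ℚ) ^ expDiff c b q) ≤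
      S.card * ((theta K a b 0 + theta K a c 0) *
        (3 * τ * Real.log (max (Real.exp 1) (2 * Real.log c)))) := by
  obtain ⟨ha, hb, habc, hcop⟩ := id h
  have hc : c ≠ 0 := by omega
  have hcb : c.Coprime b := (coprime_right_of_isABCTriple h).symm
  set Y := Real.log (max (Real.exp 1) (2 * Real.log c)) with hYdef
  have hY1 : 1 ≤ Y := one_le_log_max_exp _
  have hΘab : 0 ≤ theta K a b 0 := theta_nonneg (zero_le_one.trans hK) a b 0
  have hΘac : 0 ≤ theta K a c 0 := theta_nonneg (zero_le_one.trans hK) a c 0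
  -- per prime of `S`
  have hq : ∀ q ∈ S, ((expDiff c b q).natAbs : ℝ) * Real.log q ≤
      (theta K a b 0 + theta K a c 0) * (3 * τ * Y) := by
    intro q hqS
    have hqP := hS hqS
    have hqp : q.Prime := Nat.prime_of_mem_primeFactors hqP
    have hq2 : (2 : ℝ) ≤ q := by exact_mod_cast hqp.two_le
    have hlogq : 0 ≤ Real.log q := Real.log_nonneg (by linarith)
    have hnum : (q : ℝ) / Real.log q * (Real.log q + Y) ≤ 3 * q * Y :=
      div_log_mul_add_le hq2 hY1
    have hnum0 : 0 ≤ (q : ℝ) / Real.log q * (Real.log q + Y) := by positivity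
    have hqτ : 3 * (q : ℝ) * Y ≤ 3 * τ * Y := by
      have := hSτ q hqS; nlinarith
    -- `ν_q(c) log q ≤ Θ_{ab} (…)` and `ν_q(b) log q ≤ Θ_{ac} (…)`
    have hcq : (c.factorization q : ℝ) * Real.log q ≤
        theta K a b 0 * ((q : ℝ) / Real.log q * (Real.log q + Y)) := by
      by_cases hqc : q ∣ c
      · exact (padic_bound_c₂ hK hP2 h h1 0 hqp hqc).le
      · rw [Nat.factorization_eq_zero_of_not_dvd hqc, Nat.cast_zero, zero_mul]
        positivity
    have hbq : (b.factorization q : ℝ) * Real.log q ≤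
        theta K a c 0 * ((q : ℝ) / Real.log q * (Real.log q + Y)) := by
      by_cases hqb : q ∣ b
      · exact (padic_bound_a₂ hK hP2 h.swap 0 hqp hqb).le
      · rw [Nat.factorization_eq_zero_of_not_dvd hqb, Nat.cast_zero, zero_mul]
        positivity
    have hsplit : ((expDiff c b q).natAbs : ℝ) = c.factorization q + b.factorization q := by
      rw [natAbs_expDiff hc hb.ne' hcb q, Nat.factorization_mul hc hb.ne', Finsupp.add_apply]
      push_cast; rfl
    rw [hsplit, add_mul]
    calc (c.factorization q : ℝ) * Real.log q + (b.factorization q : ℝ) * Real.log q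
        ≤ (theta K a b 0 + theta K a c 0) * ((q : ℝ) / Real.log q * (Real.log q + Y)) := by
          linarith
      _ ≤ (theta K a b 0 + theta K a c 0) * (3 * τ * Y) :=
          mul_le_mul_of_nonneg_left (hnum.trans hqτ) (by positivity)
  -- sum over `S`
  calc logHeight₁ (∏ q ∈ S, (q : ℚ) ^ expDiff c b q)
      ≤ ∑ q ∈ S, logHeight₁ ((q : ℚ) ^ expDiff c b q) := logHeight₁_prod_le _ _
    _ = ∑ q ∈ S, ((expDiff c b q).natAbs : ℝ) * Real.log q := by
        refine Finset.sum_congr rfl fun q hqS => ?_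
        have hqp : q.Prime := Nat.prime_of_mem_primeFactors (hS hqS)
        haveI : NeZero q := ⟨hqp.ne_zero⟩
        rw [logHeight₁_zpow, Rat.logHeight₁_natCast]
    _ ≤ ∑ q ∈ S, (theta K a b 0 + theta K a c 0) * (3 * τ * Y) := Finset.sum_le_sum hq
    _ = S.card * ((theta K a b 0 + theta K a c 0) * (3 * τ * Y)) := by
        rw [Finset.sum_const, nsmul_eq_mul]

/-- **All primes of `c` small.** If every prime of `c` is `≤ τ`, then
`log c ≤ ω(c) · Θ_{ab} · 3τY` (`ab > 1`). [cite: StewartYu2001, Theorem 1 (proof), as reconstructed] -/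
theorem log_le_of_primes_le (hK : 1 ≤ K)
    (hP2 : ∀ (ι : Type) [Fintype ι], 0 < Fintype.card ι →
      ∀ ξ : ι → ℚ, (∀ i, ξ i ≠ 0 ∧ ξ i ≠ 1 ∧ ξ i ≠ -1) →
      ∀ ζ : ℚ, (ζ = 1 ∨ ζ = -1) → ∀ b : ι → ℤ, ζ * ∏ i, ξ i ^ b i ≠ 1 →
      ∀ p : ℕ, p.Prime →
        (padicValRat p (1 - ζ * ∏ i, ξ i ^ b i) : ℝ) * Real.log p <
          K ^ Fintype.card ι * (p / Real.log p) *
            Real.log (max (Real.exp 1) (p * logHeight₁ (ζ * ∏ i, ξ i ^ b i))) *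
            ∏ i, logHeight₁ (ξ i))
    (h : IsABCTriple a b c) (h1 : 1 < a * b) {τ : ℝ} (hτ : ∀ q ∈ c.primeFactors, (q : ℝ) ≤ τ) :
    Real.log c ≤ c.primeFactors.card *
      (theta K a b 0 * (3 * τ * Real.log (max (Real.exp 1) (2 * Real.log c)))) := by
  obtain ⟨ha, hb, habc, hcop⟩ := id h
  have hc : c ≠ 0 := by omega
  set Y := Real.log (max (Real.exp 1) (2 * Real.log c)) with hYdef
  have hY1 : 1 ≤ Y := one_le_log_max_exp _
  have hΘab : 0 ≤ theta K a b 0 := theta_nonneg (zero_le_one.trans hK) a b 0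
  rw [log_eq_sum_factorization_mul_log hc]
  calc ∑ q ∈ c.primeFactors, (c.factorization q : ℝ) * Real.log q
      ≤ ∑ q ∈ c.primeFactors, theta K a b 0 * (3 * τ * Y) := by
        refine Finset.sum_le_sum fun q hqc => ?_
        have hqp := Nat.prime_of_mem_primeFactors hqc
        have hq2 : (2 : ℝ) ≤ q := by exact_mod_cast hqp.two_le
        have hb1 := padic_bound_c₂ hK hP2 h h1 0 hqp (Nat.dvd_of_mem_primeFactors hqc)
        have hnum : (q : ℝ) / Real.log q * (Real.log q + Y) ≤ 3 * q * Y :=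
          div_log_mul_add_le hq2 hY1
        have hqτ : 3 * (q : ℝ) * Y ≤ 3 * τ * Y := by
          have := hτ q hqc; nlinarith
        exact hb1.le.trans (mul_le_mul_of_nonneg_left (hnum.trans hqτ) hΘab)
    _ = c.primeFactors.card * (theta K a b 0 * (3 * τ * Y)) := by
        rw [Finset.sum_const, nsmul_eq_mul]

/-- `log(e (1 + 3y)) ≤ 4 log max{e, 2y}` for `y ≥ 0`. [folklore] -/
theorem log_exp_mul_le_four_mul {y : ℝ} (hy : 0 ≤ y) :
    Real.log (Real.exp 1 * (1 + 3 * y)) ≤ 4 * Real.log (max (Real.exp 1) (2 * y)) := by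
  set m := max (Real.exp 1) (2 * y) with hm
  have he : Real.exp 1 ≤ m := le_max_left _ _
  have hy2 : 2 * y ≤ m := le_max_right _ _
  have he2 : (2.7 : ℝ) < Real.exp 1 := by have := Real.exp_one_gt_d9; linarith
  have hm0 : 0 < m := by linarith
  have key : Real.exp 1 * (1 + 3 * y) ≤ m ^ 4 := by
    have h1 : Real.exp 1 * (1 + 3 * y) ≤ m * (1 + 3 / 2 * m) := by
      apply mul_le_mul he _ (by positivity) hm0.le
      linarith
    have h2 : m * (1 + 3 / 2 * m) ≤ m ^ 4 := by
      have hm27 : (2.7 : ℝ) ≤ m := by linarith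
      nlinarith [mul_le_mul hm27 hm27 (by norm_num) hm0.le, sq_nonneg m]
    exact h1.trans h2
  have h4 : Real.log (m ^ 4) = 4 * Real.log m := by rw [Real.log_pow]; push_cast; ring
  rw [← h4]
  exact Real.log_le_log (by positivity) key

/-- `C(n) ≤ max(1, C(2), C(3), C(4))` for `2 ≤ n ≤ 4`. [folklore] -/
theorem apply_le_max_four (C : ℕ → ℝ) {n : ℕ} (h2 : 2 ≤ n) (h4 : n ≤ 4) :
    C n ≤ max 1 (max (max (C 2) (C 3)) (C 4)) := by
  interval_cases n
  · exact ((le_max_left _ _).trans (le_max_left _ _)).trans (le_max_right _ _)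
  · exact ((le_max_right _ _).trans (le_max_left _ _)).trans (le_max_right _ _)
  · exact (le_max_right _ _).trans (le_max_right _ _)

/-- Arithmetic of the second regime, all sizes `≥ 1`: with `P₀ = C' K J² τ Λ³`,
(i) `1 ≤ P₀`; (ii) `3 K J² τ Y ≤ 58 P₀ Y²`; (iii) `2 + 2 (C' Λ³ (4Y)) ≤ 58 P₀ Y²`; (iv) `4 ≤ 58 P₀ Y²`;
(v) if `H ≤ 1 + 6 K J² τ Y` then `2 + 2 (C' (Λ³ H) (4Y)) ≤ 58 P₀ Y²`. [folklore] -/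
theorem regimeII_arith {C' K J τ Λ Y H : ℝ} (hC' : 1 ≤ C') (hK : 1 ≤ K) (hJ : 1 ≤ J) (hτ : 1 ≤ τ)
    (hΛ : 1 ≤ Λ) (hY : 1 ≤ Y) (hH : H ≤ 1 + 6 * K * J ^ 2 * τ * Y) :
    1 ≤ C' * K * J ^ 2 * τ * Λ ^ 3 ∧
    3 * (K * J ^ 2 * τ) * Y ≤ 58 * (C' * K * J ^ 2 * τ * Λ ^ 3) * Y ^ 2 ∧
    2 + 2 * (C' * Λ ^ 3 * (4 * Y)) ≤ 58 * (C' * K * J ^ 2 * τ * Λ ^ 3) * Y ^ 2 ∧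
    (4 : ℝ) ≤ 58 * (C' * K * J ^ 2 * τ * Λ ^ 3) * Y ^ 2 ∧
    2 + 2 * (C' * (Λ ^ 3 * H) * (4 * Y)) ≤ 58 * (C' * K * J ^ 2 * τ * Λ ^ 3) * Y ^ 2 := by
  have hJ2 : 1 ≤ J ^ 2 := one_le_pow₀ hJ
  have hΛ3 : 1 ≤ Λ ^ 3 := one_le_pow₀ hΛ
  have hY2 : Y ≤ Y ^ 2 := by nlinarith
  have hY21 : 1 ≤ Y ^ 2 := one_le_pow₀ hY
  have hKJτ : 1 ≤ K * J ^ 2 * τ := by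
    calc (1 : ℝ) = 1 * 1 * 1 := by ring
      _ ≤ K * J ^ 2 * τ := mul_le_mul (mul_le_mul hK hJ2 zero_le_one (by linarith)) hτ zero_le_one
          (by positivity)
  have hCΛ : 1 ≤ C' * Λ ^ 3 := by nlinarith
  set P₀ := C' * K * J ^ 2 * τ * Λ ^ 3 with hP₀
  have hP₀eq : P₀ = (C' * Λ ^ 3) * (K * J ^ 2 * τ) := by rw [hP₀]; ring
  have hP₀a : K * J ^ 2 * τ ≤ P₀ := by
    rw [hP₀eq]; exact le_mul_of_one_le_left (by linarith) hCΛ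
  have hP₀b : C' * Λ ^ 3 ≤ P₀ := by
    rw [hP₀eq]; exact le_mul_of_one_le_right (by linarith) hKJτ
  have hP₀1 : 1 ≤ P₀ := hKJτ.trans hP₀a
  have hPY : 1 ≤ P₀ * Y ^ 2 := by nlinarith
  refine ⟨hP₀1, ?_, ?_, by nlinarith, ?_⟩
  · have : (K * J ^ 2 * τ) * Y ≤ P₀ * Y ^ 2 := mul_le_mul hP₀a hY2 (by linarith) (by linarith)
    nlinarith
  · have : C' * Λ ^ 3 * Y ≤ P₀ * Y ^ 2 := mul_le_mul hP₀b hY2 (by linarith) (by linarith)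
    nlinarith
  · have h1 : C' * (Λ ^ 3 * H) * (4 * Y) ≤ C' * (Λ ^ 3 * (1 + 6 * K * J ^ 2 * τ * Y)) * (4 * Y) := by
      apply mul_le_mul_of_nonneg_right _ (by linarith)
      exact mul_le_mul_of_nonneg_left (mul_le_mul_of_nonneg_left hH (by linarith)) (by linarith)
    have h2 : C' * (Λ ^ 3 * (1 + 6 * K * J ^ 2 * τ * Y)) * (4 * Y) =
        4 * (C' * Λ ^ 3 * Y) + 24 * P₀ * Y ^ 2 := by rw [hP₀]; ring
    have h3 : C' * Λ ^ 3 * Y ≤ P₀ * Y ^ 2 := mul_le_mul hP₀b hY2 (by linarith) (by linarith)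
    nlinarith

/-- **Second regime.** For an abc triple with `a ≤ b`, `ab > 1` and `a² < c`:
`log c ≤ 58 C⋆ K C₁² · R^{7/24} · Λ³ · Y²`, with `Λ = max(1, log R)`, `Y = log max{e, 2 log c}`,
`C⋆ = max(1, C(2), C(3), C(4))`, `C₁` the constant of `exists_prod_two_mul_max_log_le`; from the
`p`-adic clause (constant `K`) and the archimedean bound with ANY constant `C(n)`.
Proof: `log c < 2(log c − log a) ≤ 2 + 2 log(1/log(c/b))`; write
`c/b = β · ∏_{q ∣ bc, q > R^{1/4}} q^{e_q}` with `β` the `R^{1/4}`-smooth part (at most three large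
primes); the archimedean bound with `n ≤ 4` generators bounds `log(1/log(c/b))` by
`C⋆ Λ³ max(1, h(β)) · 4Y`, and `h(β) ≤ 6 K J² R^{1/4} Y` by the `p`-adic clause at the small
primes (`logHeight₁_smooth_le`), where `J = ∏_{q ∣ abc} 2K max(1, log q) ≤ C₁ R^{1/48}`.
[cite: StewartYu2001, Theorem 1 (proof), as reconstructed in the module docstring] -/
theorem log_le_of_sq_lt (hK : 1 ≤ K)
    (hP2 : ∀ (ι : Type) [Fintype ι], 0 < Fintype.card ι →
      ∀ ξ : ι → ℚ, (∀ i, ξ i ≠ 0 ∧ ξ i ≠ 1 ∧ ξ i ≠ -1) →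
      ∀ ζ : ℚ, (ζ = 1 ∨ ζ = -1) → ∀ b : ι → ℤ, ζ * ∏ i, ξ i ^ b i ≠ 1 →
      ∀ p : ℕ, p.Prime →
        (padicValRat p (1 - ζ * ∏ i, ξ i ^ b i) : ℝ) * Real.log p <
          K ^ Fintype.card ι * (p / Real.log p) *
            Real.log (max (Real.exp 1) (p * logHeight₁ (ζ * ∏ i, ξ i ^ b i))) *
            ∏ i, logHeight₁ (ξ i))
    (C : ℕ → ℝ) (hC0 : ∀ n, 2 ≤ n → 0 ≤ C n)
    (hA : ∀ (κ : Type) [Fintype κ], 2 ≤ Fintype.card κ → Fintype.card κ ≤ 4 →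
      ∀ (α : κ → ℚ) (b : κ → ℤ) (A : κ → ℝ) (B : ℝ),
        (∀ k, 0 < α k ∧ α k ≠ 1) → b ≠ 0 →
        ∑ k, (b k : ℝ) * Real.log (α k : ℝ) ≠ 0 →
        (∀ k, max (logHeight₁ (α k)) (max |Real.log (α k : ℝ)| 0.16) ≤ A k) →
        1 ≤ B → (∀ k, (|b k| : ℝ) ≤ B) →
        -(C (Fintype.card κ) * (∏ k, A k) * Real.log (Real.exp 1 * B)) <
          Real.log |∑ k, (b k : ℝ) * Real.log (α k : ℝ)|)
    {C₁ : ℝ}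
    (hC₁ : ∀ S : Finset ℕ, (∀ p ∈ S, p.Prime) →
      ∏ p ∈ S, 2 * K * max 1 (Real.log p) ≤ C₁ * (∏ p ∈ S, (p : ℝ)) ^ (1 / 48 : ℝ))
    (h : IsABCTriple a b c) (hab : a ≤ b) (h1 : 1 < a * b) (hac2 : (a : ℝ) ^ 2 < c) :
    Real.log c ≤ 58 * max 1 (max (max (C 2) (C 3)) (C 4)) * K * C₁ ^ 2 *
      (rad a b c : ℝ) ^ (7 / 24 : ℝ) * max 1 (Real.log (rad a b c : ℕ)) ^ 3 *
      Real.log (max (Real.exp 1) (2 * Real.log c)) ^ 2 := by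
  classical
  obtain ⟨ha, hb, habc, hcop⟩ := id h
  have hc : c ≠ 0 := by omega
  have hbc : b.Coprime c := coprime_right_of_isABCTriple h
  have hcb : c.Coprime b := hbc.symm
  have hac : a.Coprime c := coprime_left_of_isABCTriple h
  have habc0 : a * b * c ≠ 0 := by positivity
  have hK0 : 0 ≤ K := zero_le_one.trans hK
  have ha_r : (0 : ℝ) < a := by exact_mod_cast ha
  have hb_r : (0 : ℝ) < b := by exact_mod_cast hb
  have hc_r : (0 : ℝ) < c := by exact_mod_cast Nat.pos_of_ne_zero hc
  have hbc_lt : (b : ℝ) < c := by exact_mod_cast (show b < c by omega)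
  have hab_r : (a : ℝ) ≤ b := by exact_mod_cast hab
  -- notation
  set R : ℕ := rad a b c with hRdef
  have hR0n : R ≠ 0 := by
    rw [hRdef, rad_def]; exact UniqueFactorizationMonoid.radical_ne_zero
  have hR1 : (1 : ℝ) ≤ (R : ℝ) := one_le_rad_real a b c
  have hR0 : (0 : ℝ) < R := by linarith
  set Λ : ℝ := max 1 (Real.log (R : ℝ)) with hΛdef
  have hΛ1 : 1 ≤ Λ := le_max_left _ _
  set τ : ℝ := (R : ℝ) ^ (1 / 4 : ℝ) with hτdef
  have hτ1 : 1 ≤ τ := Real.one_le_rpow hR1 (by norm_num)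
  set y : ℝ := Real.log c with hydef
  have hy0 : 0 < y := Real.log_pos (by exact_mod_cast (show 1 < c by omega))
  set Y : ℝ := Real.log (max (Real.exp 1) (2 * Real.log c)) with hYdef
  have hY1 : 1 ≤ Y := one_le_log_max_exp _
  set Cmax : ℝ := max (max (C 2) (C 3)) (C 4) with hCmax
  set C' : ℝ := max 1 Cmax with hC'
  have hC'1 : 1 ≤ C' := le_max_left _ _
  have hCle : ∀ n, 2 ≤ n → n ≤ 4 → C n ≤ C' := fun n hn2 hn4 => by
    rw [hC', hCmax]; exact apply_le_max_four C hn2 hn4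
  set J : ℝ := ∏ q ∈ (a * b * c).primeFactors, 2 * K * max 1 (Real.log q) with hJdef
  have hJ1 : 1 ≤ J := one_le_prod_two_mul_max hK _
  have hΘab : theta K a b 0 ≤ K * J :=
    theta_zero_le_mul_prod hK ha.ne' hb.ne' hcop habc0 (Dvd.intro c rfl)
  have hΘac : theta K a c 0 ≤ K * J :=
    theta_zero_le_mul_prod hK ha.ne' hc hac habc0 (Dvd.intro b (by ring))
  have hΘab0 : 0 ≤ theta K a b 0 := theta_nonneg hK0 a b 0
  have hΘac0 : 0 ≤ theta K a c 0 := theta_nonneg hK0 a c 0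
  -- primes of `cb`, small and large
  set P : Finset ℕ := (c * b).primeFactors with hPdef
  have hcbdvd : c * b ∣ a * b * c := Dvd.intro_left a (by ring)
  have hPsub : P ⊆ (a * b * c).primeFactors := Nat.primeFactors_mono hcbdvd habc0
  have hPprime : ∀ q ∈ P, q.Prime := fun q hq => Nat.prime_of_mem_primeFactors hq
  have hcardP : (P.card : ℝ) ≤ J :=
    le_trans (by exact_mod_cast Finset.card_le_card hPsub) (card_primeFactors_le_prod hK _)
  set S : Finset ℕ := P.filter (fun q => (q : ℝ) ≤ τ) with hSdef
  set L : Finset ℕ := P.filter (fun q => ¬(q : ℝ) ≤ τ) with hLdef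
  have hSsub : S ⊆ P := Finset.filter_subset _ _
  have hLsub : L ⊆ P := Finset.filter_subset _ _
  have hSτ : ∀ q ∈ S, (q : ℝ) ≤ τ := fun q hq => (Finset.mem_filter.mp hq).2
  have hLτ : ∀ q ∈ L, τ < q := fun q hq => lt_of_not_ge (Finset.mem_filter.mp hq).2
  have hLprime : ∀ q ∈ L, q.Prime := fun q hq => hPprime q (hLsub hq)
  have hcardS : (S.card : ℝ) ≤ J :=
    le_trans (by exact_mod_cast Finset.card_le_card hSsub) hcardP
  -- at most three large primes
  have hL3 : L.card ≤ 3 := by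
    refine card_le_three_of_quarter_lt hR0n L ?_ hLτ
    have h1' : ∏ q ∈ L, q ∣ ∏ q ∈ (a * b * c).primeFactors, q :=
      Finset.prod_dvd_prod_of_subset _ _ _ (hLsub.trans hPsub)
    rwa [← Nat.radical_eq_prod_primeFactors, ← rad_def] at h1'
  -- `log q ≤ Λ` on `P`, so `∏_{L} log q ≤ Λ³`
  have hlogP : ∀ q ∈ P, Real.log q ≤ Λ := by
    intro q hq
    have hqp := hPprime q hq
    have hqR : (q : ℝ) ≤ R := by
      exact_mod_cast prime_le_rad hqp ((Nat.dvd_of_mem_primeFactors hq).trans hcbdvd) habc0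
    exact (Real.log_le_log (by exact_mod_cast hqp.pos) hqR).trans (le_max_right _ _)
  have hlogP0 : ∀ q ∈ P, 0 ≤ Real.log q := fun q hq =>
    Real.log_nonneg (by exact_mod_cast (hPprime q hq).one_lt.le)
  have hprodL : ∏ q ∈ L, Real.log q ≤ Λ ^ 3 := by
    calc ∏ q ∈ L, Real.log q ≤ ∏ _q ∈ L, Λ :=
          Finset.prod_le_prod (fun q hq => hlogP0 q (hLsub hq)) fun q hq => hlogP q (hLsub hq)
      _ = Λ ^ L.card := Finset.prod_const Λ
      _ ≤ Λ ^ 3 := pow_le_pow_right₀ hΛ1 hL3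
  have hprodL0 : 0 ≤ ∏ q ∈ L, Real.log q := Finset.prod_nonneg fun q hq => hlogP0 q (hLsub hq)
  -- the smooth part `β` and the splitting of `c/b`
  set e : ℕ → ℤ := expDiff c b with hedef
  set β : ℚ := ∏ q ∈ S, (q : ℚ) ^ e q with hβdef
  have hβpos : 0 < β := Finset.prod_pos fun q hq =>
    zpow_pos (by exact_mod_cast (hPprime q (hSsub hq)).pos) _
  have hsplitQ : (c : ℚ) / b = β * ∏ q ∈ L, (q : ℚ) ^ e q := by
    rw [cast_div_eq_prod_zpow hc hb.ne' hcb, hβdef, hSdef, hLdef,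
      Finset.prod_filter_mul_prod_filter_not]
  set Λ₀ : ℝ := Real.log c - Real.log b with hΛ₀def
  have hΛ₀eq : Λ₀ = Real.log (β : ℝ) + ∑ q ∈ L, (e q : ℝ) * Real.log q := by
    have hcast : (((c : ℚ) / b : ℚ) : ℝ) = (c : ℝ) / b := by push_cast; rfl
    have hq0 : ∀ q ∈ L, ((q : ℝ)) ^ e q ≠ 0 := fun q hq =>
      zpow_ne_zero _ (by exact_mod_cast (hLprime q hq).ne_zero)
    have h2 : (((c : ℚ) / b : ℚ) : ℝ) = (β : ℝ) * ∏ q ∈ L, (q : ℝ) ^ e q := by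
      rw [hsplitQ]; push_cast; rfl
    have hβr : (β : ℝ) ≠ 0 := by exact_mod_cast hβpos.ne'
    have hprod0 : ∏ q ∈ L, (q : ℝ) ^ e q ≠ 0 := Finset.prod_ne_zero_iff.mpr hq0
    calc Λ₀ = Real.log ((c : ℝ) / b) := (Real.log_div hc_r.ne' hb_r.ne').symm
      _ = Real.log ((β : ℝ) * ∏ q ∈ L, (q : ℝ) ^ e q) := by rw [← hcast, h2]
      _ = Real.log (β : ℝ) + ∑ q ∈ L, Real.log ((q : ℝ) ^ e q) := by
          rw [Real.log_mul hβr hprod0, Real.log_prod hq0]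
      _ = Real.log (β : ℝ) + ∑ q ∈ L, (e q : ℝ) * Real.log q := by
          congr 1
          exact Finset.sum_congr rfl fun q _ => Real.log_zpow _ _
  -- `0 < Λ₀ ≤ a/b ≤ 1`
  have hΛ₀pos : 0 < Λ₀ := by
    rw [hΛ₀def]; linarith only [Real.log_lt_log hb_r hbc_lt]
  have hΛ₀le : Λ₀ ≤ (a : ℝ) / b := by
    have h1' : Real.log ((c : ℝ) / b) ≤ (c : ℝ) / b - 1 := Real.log_le_sub_one_of_pos (by positivity)
    have h2 : (c : ℝ) / b - 1 = (a : ℝ) / b := by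
      have : (c : ℝ) = a + b := by exact_mod_cast habc.symm
      rw [this, add_div, div_self hb_r.ne']; ring
    rw [hΛ₀def, ← Real.log_div hc_r.ne' hb_r.ne']
    linarith only [h1', h2]
  have hab1 : (a : ℝ) / b ≤ 1 := (div_le_one hb_r).mpr hab_r
  -- `y < 2 + 2 · (−log Λ₀)`
  have hstar : y < 2 + 2 * (-Real.log Λ₀) := by
    have h2a : 2 * Real.log a < y := by
      have h' : Real.log ((a : ℝ) ^ 2) < Real.log c := Real.log_lt_log (by positivity) hac2
      have h'' : Real.log ((a : ℝ) ^ 2) = 2 * Real.log a := by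
        rw [Real.log_pow]; push_cast; ring
      rw [hydef]; linarith only [h', h'']
    have hlogΛ₀ : Real.log Λ₀ ≤ Real.log a - Real.log b := by
      rw [← Real.log_div ha_r.ne' hb_r.ne']
      exact Real.log_le_log hΛ₀pos hΛ₀le
    have hΛ₀1 : Λ₀ ≤ 1 := hΛ₀le.trans hab1
    have hyΛ : y - Real.log a = Λ₀ + (Real.log b - Real.log a) := by rw [hΛ₀def]; ring
    linarith only [h2a, hlogΛ₀, hΛ₀1, hyΛ]
  -- exponents: `|e_q| ≤ 1 + 3y`
  set E : ℝ := 1 + 3 * y with hEdef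
  have hE1 : 1 ≤ E := by rw [hEdef]; linarith
  have hE : ∀ q ∈ L, (|e q| : ℝ) ≤ E := by
    intro q hq
    have hqp := hLprime q hq
    have hnat : (|e q| : ℝ) = ((expDiff c b q).natAbs : ℝ) := by
      rw [Nat.cast_natAbs, Int.cast_abs]
    rw [hnat, natAbs_expDiff hc hb.ne' hcb q]
    have h1' := factorization_le_log (mul_ne_zero hc hb.ne') hqp
    have h2 : Real.log ((c * b : ℕ) : ℝ) ≤ 2 * y := by
      push_cast
      rw [Real.log_mul hc_r.ne' hb_r.ne', hydef]
      linarith only [Real.log_le_log hb_r hbc_lt.le]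
    have h3 : (0 : ℝ) ≤ y := hy0.le
    rw [hEdef]; linarith only [h1', h2, h3]
  have hlogE : Real.log (Real.exp 1 * E) ≤ 4 * Y := by
    rw [hEdef, hYdef]; exact log_exp_mul_le_four_mul hy0.le
  have hlogE0 : 0 ≤ Real.log (Real.exp 1 * E) :=
    Real.log_nonneg (one_le_mul_of_one_le_of_one_le
      (by linarith only [Real.add_one_le_exp (1 : ℝ)]) hE1)
  -- the target of all cases
  set M : ℝ := 58 * C' * K * J ^ 2 * τ * Λ ^ 3 with hMdef
  have hMeq : 58 * (C' * K * J ^ 2 * τ * Λ ^ 3) * Y ^ 2 = M * Y ^ 2 := by rw [hMdef]; ring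
  have hyM : y ≤ M * Y ^ 2 := by
    rcases Finset.eq_empty_or_nonempty L with hLe | hLne
    · -- every prime of `cb` is small: bound `log c` through the primes of `c` directly
      have hsmall : ∀ q ∈ c.primeFactors, (q : ℝ) ≤ τ := by
        intro q hq
        have hqP : q ∈ P := Nat.primeFactors_mono (Dvd.intro b rfl) (mul_ne_zero hc hb.ne') hq
        by_contra hqτ
        have : q ∈ L := Finset.mem_filter.mpr ⟨hqP, hqτ⟩
        rw [hLe] at this
        exact Finset.notMem_empty q this
      have h1' := log_le_of_primes_le hK hP2 h h1 hsmall
      have hsubc : c.primeFactors ⊆ (a * b * c).primeFactors :=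
        Nat.primeFactors_mono (Dvd.intro_left (a * b) rfl) habc0
      have hcardc : (c.primeFactors.card : ℝ) ≤ J :=
        le_trans (by exact_mod_cast Finset.card_le_card hsubc) (card_primeFactors_le_prod hK _)
      obtain ⟨-, hA2, -, -, -⟩ := regimeII_arith (H := 1 + 6 * K * J ^ 2 * τ * Y) hC'1 hK hJ1 hτ1
        hΛ1 hY1 le_rfl
      calc y ≤ c.primeFactors.card * (theta K a b 0 * (3 * τ * Y)) := h1'
        _ ≤ J * (K * J * (3 * τ * Y)) := by
            apply mul_le_mul hcardc _ (by positivity) (zero_le_one.trans hJ1)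
            exact mul_le_mul_of_nonneg_right hΘab (by positivity)
        _ = 3 * (K * J ^ 2 * τ) * Y := by ring
        _ ≤ 58 * (C' * K * J ^ 2 * τ * Λ ^ 3) * Y ^ 2 := hA2
        _ = M * Y ^ 2 := hMeq
    · rcases eq_or_ne β 1 with hβ1 | hβ1
      · -- `Λ₀ = ∑_{q ∈ L} e_q log q`
        have hΛ₀eq' : Λ₀ = ∑ q ∈ L, (e q : ℝ) * Real.log q := by
          rw [hΛ₀eq, hβ1]; push_cast; rw [Real.log_one, zero_add]
        rcases le_or_gt 2 L.card with hL2 | hL2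
        · have hne : ∑ q ∈ L, (e q : ℝ) * Real.log q ≠ 0 := by rw [← hΛ₀eq']; exact hΛ₀pos.ne'
          have key := arch_lower_bound_one C hA L hLprime hL2 (by omega) e hE1 hE hne
          rw [← hΛ₀eq', abs_of_pos hΛ₀pos] at key
          -- `−log Λ₀ < C(#L) ∏ log q · log(eE) ≤ C' Λ³ · 4Y`
          have hCn : C L.card ≤ C' := hCle _ hL2 (by omega)
          have hCn0 : 0 ≤ C L.card := hC0 _ hL2
          have hneg : -Real.log Λ₀ ≤ C' * Λ ^ 3 * (4 * Y) := by
            have h' : C L.card * (∏ q ∈ L, Real.log q) * Real.log (Real.exp 1 * E) ≤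
                C' * Λ ^ 3 * (4 * Y) :=
              mul_le_mul (mul_le_mul hCn hprodL hprodL0 (zero_le_one.trans hC'1)) hlogE hlogE0
                (by positivity)
            linarith only [h', key]
          obtain ⟨-, -, hA3, -, -⟩ := regimeII_arith (H := 1 + 6 * K * J ^ 2 * τ * Y) hC'1 hK hJ1
            hτ1 hΛ1 hY1 le_rfl
          calc y ≤ 2 + 2 * (C' * Λ ^ 3 * (4 * Y)) := by linarith only [hstar, hneg]
            _ ≤ 58 * (C' * K * J ^ 2 * τ * Λ ^ 3) * Y ^ 2 := hA3
            _ = M * Y ^ 2 := hMeq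
        · -- exactly one large prime and `β = 1`: `Λ₀ = e log q₀ ≥ 1/2`
          have hL1 : L.card = 1 := by have := hLne.card_pos; omega
          obtain ⟨q₀, hLq₀⟩ := Finset.card_eq_one.mp hL1
          have hq₀L : q₀ ∈ L := by rw [hLq₀]; exact Finset.mem_singleton_self q₀
          have hq₀p := hLprime q₀ hq₀L
          have hΛ₀q : Λ₀ = (e q₀ : ℝ) * Real.log q₀ := by rw [hΛ₀eq', hLq₀, Finset.sum_singleton]
          have hlogq₀ : Real.log 2 ≤ Real.log q₀ :=
            Real.log_le_log two_pos (by exact_mod_cast hq₀p.two_le)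
          have hlog2 : (1 / 2 : ℝ) < Real.log 2 := by have := Real.log_two_gt_d9; linarith
          have hlogq₀0 : 0 < Real.log q₀ := by linarith only [hlogq₀, hlog2]
          have he1 : (1 : ℝ) ≤ e q₀ := by
            have hpos : (0 : ℝ) < e q₀ := by
              by_contra hle
              push Not at hle
              have h' : Λ₀ ≤ 0 := by rw [hΛ₀q]; exact mul_nonpos_of_nonpos_of_nonneg hle hlogq₀0.le
              linarith only [h', hΛ₀pos]
            exact_mod_cast (show (1 : ℤ) ≤ e q₀ by exact_mod_cast hpos)
          have hΛ₀ge : 1 / 2 ≤ Λ₀ := by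
            rw [hΛ₀q]
            calc (1 / 2 : ℝ) ≤ 1 * Real.log q₀ := by linarith only [hlogq₀, hlog2]
              _ ≤ (e q₀ : ℝ) * Real.log q₀ := mul_le_mul_of_nonneg_right he1 hlogq₀0.le
          have hneg : -Real.log Λ₀ ≤ 1 := by
            have h' : Real.log (1 / 2) ≤ Real.log Λ₀ := Real.log_le_log (by norm_num) hΛ₀ge
            have h12 : Real.log (1 / 2) = -Real.log 2 := by
              rw [one_div, Real.log_inv]
            have h2 := Real.log_two_lt_d9
            linarith only [h', h12, h2]
          obtain ⟨-, -, -, hA4, -⟩ := regimeII_arith (H := 1 + 6 * K * J ^ 2 * τ * Y) hC'1 hK hJ1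
            hτ1 hΛ1 hY1 le_rfl
          calc y ≤ 4 := by linarith only [hstar, hneg]
            _ ≤ 58 * (C' * K * J ^ 2 * τ * Λ ^ 3) * Y ^ 2 := hA4
            _ = M * Y ^ 2 := hMeq
      · -- `β ≠ 1`: the archimedean bound with generators `L ∪ {β}`
        have hne : Real.log (β : ℝ) + ∑ q ∈ L, (e q : ℝ) * Real.log q ≠ 0 := by
          rw [← hΛ₀eq]; exact hΛ₀pos.ne'
        have key := arch_lower_bound_beta C hA L hLprime hLne hL3 e hβpos hβ1 hE1 hE hne
        rw [← hΛ₀eq, abs_of_pos hΛ₀pos] at key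
        have hL2 : 2 ≤ L.card + 1 := by have := hLne.card_pos; omega
        have hCn : C (L.card + 1) ≤ C' := hCle _ hL2 (by omega)
        have hCn0 : 0 ≤ C (L.card + 1) := hC0 _ hL2
        -- the height of `β`
        set H : ℝ := max 1 (logHeight₁ β) with hHdef
        have hH0 : 0 ≤ H := zero_le_one.trans (le_max_left _ _)
        have hhβ := logHeight₁_smooth_le hK hP2 h h1 S hSsub hSτ
        have h6 : logHeight₁ β ≤ 6 * K * J ^ 2 * τ * Y := by
          calc logHeight₁ β ≤ S.card * ((theta K a b 0 + theta K a c 0) * (3 * τ * Y)) := hhβ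
            _ ≤ J * ((K * J + K * J) * (3 * τ * Y)) := by
                apply mul_le_mul hcardS _ (by positivity) (zero_le_one.trans hJ1)
                exact mul_le_mul_of_nonneg_right (add_le_add hΘab hΘac) (by positivity)
            _ = 6 * K * J ^ 2 * τ * Y := by ring
        have h60 : 0 ≤ 6 * K * J ^ 2 * τ * Y := by positivity
        have hh0 : 0 ≤ logHeight₁ β := zero_le_logHeight₁ _
        have hHle : H ≤ 1 + 6 * K * J ^ 2 * τ * Y :=
          max_le (by linarith only [h60]) (by linarith only [h6, hh0])
        have hneg : -Real.log Λ₀ ≤ C' * (Λ ^ 3 * H) * (4 * Y) := by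
          have h' : C (L.card + 1) * ((∏ q ∈ L, Real.log q) * H) * Real.log (Real.exp 1 * E) ≤
              C' * (Λ ^ 3 * H) * (4 * Y) :=
            mul_le_mul (mul_le_mul hCn (mul_le_mul_of_nonneg_right hprodL hH0)
              (by positivity) (zero_le_one.trans hC'1)) hlogE hlogE0 (by positivity)
          linarith only [h', key]
        obtain ⟨-, -, -, -, hA5⟩ := regimeII_arith hC'1 hK hJ1 hτ1 hΛ1 hY1 hHle
        calc y ≤ 2 + 2 * (C' * (Λ ^ 3 * H) * (4 * Y)) := by linarith only [hstar, hneg]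
          _ ≤ 58 * (C' * K * J ^ 2 * τ * Λ ^ 3) * Y ^ 2 := hA5
          _ = M * Y ^ 2 := hMeq
  -- absorb `J² τ ≤ C₁² R^{7/24}`
  have hJle : J ≤ C₁ * (R : ℝ) ^ (1 / 48 : ℝ) := by
    have h1' := hC₁ (a * b * c).primeFactors fun q hq => Nat.prime_of_mem_primeFactors hq
    have hprod : ∏ q ∈ (a * b * c).primeFactors, (q : ℝ) = R := by
      rw [hRdef, rad_def, Nat.radical_eq_prod_primeFactors, Nat.cast_prod]
    rwa [hprod] at h1'
  have hJ2τ : J ^ 2 * τ ≤ C₁ ^ 2 * (R : ℝ) ^ (7 / 24 : ℝ) := by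
    have h48 : ((R : ℝ) ^ (1 / 48 : ℝ)) ^ 2 * (R : ℝ) ^ (1 / 4 : ℝ) = (R : ℝ) ^ (7 / 24 : ℝ) := by
      rw [← Real.rpow_mul_natCast hR0.le, ← Real.rpow_add hR0]; norm_num
    calc J ^ 2 * τ ≤ (C₁ * (R : ℝ) ^ (1 / 48 : ℝ)) ^ 2 * τ :=
          mul_le_mul_of_nonneg_right (pow_le_pow_left₀ (zero_le_one.trans hJ1) hJle 2)
            (zero_le_one.trans hτ1)
      _ = C₁ ^ 2 * (((R : ℝ) ^ (1 / 48 : ℝ)) ^ 2 * (R : ℝ) ^ (1 / 4 : ℝ)) := by rw [hτdef]; ring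
      _ = C₁ ^ 2 * (R : ℝ) ^ (7 / 24 : ℝ) := by rw [h48]
  calc y ≤ M * Y ^ 2 := hyM
    _ = 58 * C' * K * (J ^ 2 * τ) * Λ ^ 3 * Y ^ 2 := by rw [hMdef]; ring
    _ ≤ 58 * C' * K * (C₁ ^ 2 * (R : ℝ) ^ (7 / 24 : ℝ)) * Λ ^ 3 * Y ^ 2 := by
        apply mul_le_mul_of_nonneg_right _ (by positivity)
        apply mul_le_mul_of_nonneg_right _ (by positivity)
        exact mul_le_mul_of_nonneg_left hJ2τ (by positivity)
    _ = 58 * max 1 (max (max (C 2) (C 3)) (C 4)) * K * C₁ ^ 2 *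
          (rad a b c : ℝ) ^ (7 / 24 : ℝ) * max 1 (Real.log (rad a b c : ℕ)) ^ 3 * Y ^ 2 := by
        rw [hC', hCmax, hΛdef, hRdef]; ring

end RegimeTwo


/-! ### Adapters: from Theorem 3.2.8 over `ℚ` at the finite places to the `p`-adic clause -/

section Adapters

/-- **The finite-place half of Evertse–Győry's Theorem 4.2.1 over `ℚ` from the finite-place
half of their Theorem 3.2.8 over `ℚ`** — the book's §4.4 (pp. 80–81) run at the primes only:
this is `Dioph.evertseGyory_thm_4_2_1_rat_of_thm_3_2_8` with the archimedean conjunct deleted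
from hypothesis and conclusion (same proof: `exists_small_exponents` = Prop. 4.4.1,
`B := m^{2m} h(ξ)/log 2`, Case A via the hypothesis, Case B via the Liouville inequality).
[cite: EvertseGyory2015, Thm 4.2.1 (p. 68), proof pp. 80–81] -/
theorem evertseGyory_finite_of_thm328_finite
    (h328 : ∀ (ι : Type) [Fintype ι], 0 < Fintype.card ι →
      ∀ α : ι → ℚ, (∀ i, α i ≠ 0 ∧ α i ≠ 1 ∧ α i ≠ -1) →
      ∀ β : ℚ, β ≠ 0 → ∀ s : ℤ, (s = 1 ∨ s = -1) → ∀ b : ι → ℤ,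
        (∏ i, α i ^ b i) * β ^ s - 1 ≠ 0 →
      ∀ B : ℝ, (∀ i, (|b i| : ℝ) ≤ B) →
        2 * Real.exp 1 * 9 ^ (Fintype.card ι + 1) * (∏ i, logHeight₁ (α i)) *
            max (logHeight₁ β) 1 ≤ B →
        ∀ p : ℕ, p.Prime →
          -(egC6 (Fintype.card ι + 1) * (p / Real.log p) * (∏ i, logHeight₁ (α i)) *
              max (logHeight₁ β) 1 * logStar (B * p / max (logHeight₁ β) 1)) <
            -(padicValRat p ((∏ i, α i ^ b i) * β ^ s - 1) : ℝ) * Real.log p)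
    (ι : Type) [Fintype ι] (hι : 0 < Fintype.card ι)
    (ξ : ι → ℚ) (hξ : ∀ i, ξ i ≠ 0 ∧ ξ i ≠ 1 ∧ ξ i ≠ -1)
    (α : ℚ) (hα : α ≠ 0) (ζ : ℚ) (hζ : ζ = 1 ∨ ζ = -1) (b : ι → ℤ)
    (hne : α * (ζ * ∏ i, ξ i ^ b i) ≠ 1) (p : ℕ) (hp : p.Prime) :
    -(egC8 (Fintype.card ι) * (p / Real.log p) * (∏ i, logHeight₁ (ξ i)) *
        max (logHeight₁ α) 1 *
        logStar (p * logHeight₁ (ζ * ∏ i, ξ i ^ b i) / max (logHeight₁ α) 1)) <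
      -(padicValRat p (1 - α * (ζ * ∏ i, ξ i ^ b i)) : ℝ) * Real.log p := by
  obtain ⟨ξ', ζ', b', hξ', hζ', hxeq, hΘle, hb'⟩ := exists_small_exponents hι ξ hξ ζ hζ b
  set m := Fintype.card ι with hm
  have hm1 : 1 ≤ m := hι
  set x : ℚ := ζ * ∏ i, ξ i ^ b i with hx
  set Θ := ∏ i, logHeight₁ (ξ i) with hΘ
  set Θ' := ∏ i, logHeight₁ (ξ' i) with hΘ'
  set H := max (logHeight₁ α) 1 with hH
  have hH1 : 1 ≤ H := le_max_right _ _
  have hH0 : 0 < H := by linarith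
  have hlog2 : 0 < Real.log 2 := Real.log_pos one_lt_two
  have hΘ'pos : 0 < Θ' := by
    apply Finset.prod_pos; intro i _
    exact lt_of_lt_of_le hlog2 (log_two_le_logHeight₁ (hξ' i).1 (hξ' i).2.1 (hξ' i).2.2)
  have hΘlow : Real.log 2 ^ m ≤ Θ := by
    have : ∏ _i : ι, Real.log 2 = Real.log 2 ^ m := by rw [Finset.prod_const, Finset.card_univ]
    rw [← this]
    exact Finset.prod_le_prod (fun i _ => hlog2.le) fun i _ =>
      log_two_le_logHeight₁ (hξ i).1 (hξ i).2.1 (hξ i).2.2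
  have hhx : 0 ≤ logHeight₁ x := zero_le_logHeight₁ _
  -- c₁₇' and B
  set c : ℝ := (m : ℝ) ^ (2 * m) / Real.log 2 with hc
  set B : ℝ := c * logHeight₁ x with hB
  have hBb : ∀ i, (|b' i| : ℝ) ≤ B := by
    intro i
    calc (|b' i| : ℝ) ≤ (m : ℝ) ^ (2 * m) * logHeight₁ x / Real.log 2 := hb' i
      _ = B := by rw [hB, hc]; ring
  -- N(v)/log N(v) ≥ e
  have hkp : ∀ p : ℕ, p.Prime → Real.exp 1 ≤ p / Real.log p := fun p hp =>
    exp_one_le_div_log (by exact_mod_cast hp.one_lt)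
  have he0 : 0 < Real.exp 1 := Real.exp_pos 1
  by_cases hcase : 2 * Real.exp 1 * 9 ^ (m + 1) * Θ' * H ≤ B
  · -- Case A: Theorem 3.2.8 with α := ξ', β := ζ' α, s := 1, b := b', B
    have hζ'0 : ζ' ≠ 0 := by rcases hζ' with rfl | rfl <;> norm_num
    have hβ : ζ' * α ≠ 0 := mul_ne_zero hζ'0 hα
    have hΛeq : (∏ i, ξ' i ^ b' i) * (ζ' * α) ^ (1 : ℤ) - 1 = -(1 - α * x) := by
      rw [zpow_one, hxeq]; ring
    have hΛ : (∏ i, ξ' i ^ b' i) * (ζ' * α) ^ (1 : ℤ) - 1 ≠ 0 := by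
      rw [hΛeq, neg_ne_zero, sub_ne_zero]; exact Ne.symm hne
    have hHβ : max (logHeight₁ (ζ' * α)) 1 = H := by
      rcases hζ' with rfl | rfl
      · rw [one_mul]
      · rw [neg_one_mul, logHeight₁_neg]
    have hB' : 2 * Real.exp 1 * 9 ^ (Fintype.card ι + 1) * (∏ i, logHeight₁ (ξ' i)) *
        max (logHeight₁ (ζ' * α)) 1 ≤ B := by rw [hHβ]; exact hcase
    have hF := h328 ι hι ξ' hξ' (ζ' * α) hβ 1 (Or.inl rfl) b' hΛ B hBb hB'
    have hFp := hF p hp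
    rw [hHβ, hΛeq] at hFp
    rw [padicValRat.neg] at hFp
    have hp0 : (0 : ℝ) ≤ p := Nat.cast_nonneg p
    have hkey := eg421_caseA_bound m (k := p / Real.log p) (Nv := p) hΘle hΘ'pos.le hH1 hhx hp0
      (le_trans he0.le (hkp p hp))
    have heq : (m : ℝ) ^ (2 * m) / Real.log 2 * logHeight₁ x * p / H = B * p / H := by
      rw [hB, hc]
    rw [heq] at hkey
    linarith
  · -- Case B: Liouville
    push Not at hcase
    have hy : α * x ≠ 1 := hne
    have hhy : logHeight₁ (α * x) ≤ H + logHeight₁ x :=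
      le_trans (logHeight₁_mul_le α x) (by linarith [le_max_left (logHeight₁ α) 1])
    -- h(x) < 2e 9^{m+1} Θ' H / c ≤ 2e 9^{m+1} Θ H
    have hcpos : 0 < c := by
      rw [hc]
      have : (0 : ℝ) < m := by exact_mod_cast hm1
      positivity
    have hcinv : 1 / c ≤ 1 := by
      rw [hc, one_div_div]
      have hl2' : Real.log 2 ≤ 1 := by
        have := Real.log_two_lt_d9; linarith
      have hmm : (1 : ℝ) ≤ (m : ℝ) ^ (2 * m) := one_le_pow₀ (by exact_mod_cast hm1)
      calc Real.log 2 / (m : ℝ) ^ (2 * m) ≤ Real.log 2 / 1 :=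
            div_le_div_of_nonneg_left hlog2.le one_pos hmm
        _ ≤ 1 := by rw [div_one]; exact hl2'
    have hxlt : logHeight₁ x < 2 * Real.exp 1 * 9 ^ (m + 1) * Θ * H := by
      have h1 : logHeight₁ x = B * (1 / c) := by
        rw [hB]; field_simp
      have h2 : B * (1 / c) < (2 * Real.exp 1 * 9 ^ (m + 1) * Θ' * H) * (1 / c) :=
        mul_lt_mul_of_pos_right hcase (by positivity)
      have h3 : (2 * Real.exp 1 * 9 ^ (m + 1) * Θ' * H) * (1 / c) ≤
          (2 * Real.exp 1 * 9 ^ (m + 1) * Θ' * H) * 1 :=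
        mul_le_mul_of_nonneg_left hcinv (by positivity)
      have h4 : 2 * Real.exp 1 * 9 ^ (m + 1) * Θ' * H ≤ 2 * Real.exp 1 * 9 ^ (m + 1) * Θ * H := by
        apply mul_le_mul_of_nonneg_right _ hH0.le
        exact mul_le_mul_of_nonneg_left hΘle (by positivity)
      linarith
    have ht : Real.log 2 + logHeight₁ (α * x) <
        Real.log 2 + H + 2 * Real.exp 1 * 9 ^ (m + 1) * Θ * H := by linarith
    have h1 := liouville_finite hy p hp
    have h2 := eg421_caseB_bound m hm1 (k := p / Real.log p)
      (L := logStar (p * logHeight₁ x / H)) hΘlow hH1 (hkp p hp) (one_le_logStar _) ht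
    linarith

/-- **The `p`-adic clause of Pasten's Theorem 2.1 (`d = 1`, constant `K = pastenK`) from the
finite-place half of Evertse–Győry's Theorem 3.2.8 over `ℚ`** (`α = 1`, `H = 1`,
`5 c₈(m) ≤ K^m`; the finite half of `Dioph.pasten2024_thm_2_1`).
[cite: Pasten2024, Theorem 2.1 (ii)] [cite: EvertseGyory2015, Thm 3.2.8 (p. 62)] -/
theorem padicClause_of_thm328_finite
    (h328 : ∀ (ι : Type) [Fintype ι], 0 < Fintype.card ι →
      ∀ α : ι → ℚ, (∀ i, α i ≠ 0 ∧ α i ≠ 1 ∧ α i ≠ -1) →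
      ∀ β : ℚ, β ≠ 0 → ∀ s : ℤ, (s = 1 ∨ s = -1) → ∀ b : ι → ℤ,
        (∏ i, α i ^ b i) * β ^ s - 1 ≠ 0 →
      ∀ B : ℝ, (∀ i, (|b i| : ℝ) ≤ B) →
        2 * Real.exp 1 * 9 ^ (Fintype.card ι + 1) * (∏ i, logHeight₁ (α i)) *
            max (logHeight₁ β) 1 ≤ B →
        ∀ p : ℕ, p.Prime →
          -(egC6 (Fintype.card ι + 1) * (p / Real.log p) * (∏ i, logHeight₁ (α i)) *
              max (logHeight₁ β) 1 * logStar (B * p / max (logHeight₁ β) 1)) <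
            -(padicValRat p ((∏ i, α i ^ b i) * β ^ s - 1) : ℝ) * Real.log p) :
    ∀ (ι : Type) [Fintype ι], 0 < Fintype.card ι →
      ∀ ξ : ι → ℚ, (∀ i, ξ i ≠ 0 ∧ ξ i ≠ 1 ∧ ξ i ≠ -1) →
      ∀ ζ : ℚ, (ζ = 1 ∨ ζ = -1) → ∀ b : ι → ℤ, ζ * ∏ i, ξ i ^ b i ≠ 1 →
      ∀ p : ℕ, p.Prime →
        (padicValRat p (1 - ζ * ∏ i, ξ i ^ b i) : ℝ) * Real.log p <
          pastenK ^ Fintype.card ι * (p / Real.log p) *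
            Real.log (max (Real.exp 1) (p * logHeight₁ (ζ * ∏ i, ξ i ^ b i))) *
            ∏ i, logHeight₁ (ξ i) := by
  intro ι _ hι ξ hξ ζ hζ b hx p hp
  set x : ℚ := ζ * ∏ i, ξ i ^ b i with hxdef
  have hx1 : (1 : ℚ) * x ≠ 1 := by rwa [one_mul]
  have hN := evertseGyory_finite_of_thm328_finite h328 ι hι ξ hξ 1 one_ne_zero ζ hζ b hx1 p hp
  have hH : max (logHeight₁ (1 : ℚ)) 1 = 1 := by rw [logHeight₁_one, max_eq_right zero_le_one]
  simp only [hH, mul_one, div_one, one_mul] at hN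
  have hΘ : 0 ≤ ∏ i, logHeight₁ (ξ i) := Finset.prod_nonneg fun i _ => zero_le_logHeight₁ _
  have hK : 5 * egC8 (Fintype.card ι) ≤ pastenK ^ Fintype.card ι := five_mul_egC8_le _ hι
  have hc8 : 0 ≤ egC8 (Fintype.card ι) := by
    rw [egC8_def]
    have : (0 : ℝ) ≤ (if Fintype.card ι = 1 then (12 : ℝ) else 1) := by split_ifs <;> norm_num
    have h16 : (0 : ℝ) ≤ 16 * Real.exp 1 := by positivity
    have hm : (0 : ℝ) ≤ max 1 (Real.log (Fintype.card ι)) := le_trans zero_le_one (le_max_left _ _)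
    positivity
  have hlogmax1 : ∀ u : ℝ, 1 ≤ Real.log (max (Real.exp 1) u) := fun u => by
    rw [← Real.log_exp 1]
    exact Real.log_le_log (Real.exp_pos 1) (by rw [Real.log_exp]; exact le_max_left _ _)
  have hp0 : (0 : ℝ) < p := by exact_mod_cast hp.pos
  have hlogp : 0 < Real.log p := Real.log_pos (by exact_mod_cast hp.one_lt)
  rw [logStar_eq_log_max (by positivity)] at hN
  calc (padicValRat p (1 - x) : ℝ) * Real.log p
      < egC8 (Fintype.card ι) * (p / Real.log p) * (∏ i, logHeight₁ (ξ i)) *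
          Real.log (max (Real.exp 1) (p * logHeight₁ x)) := by linarith
    _ = egC8 (Fintype.card ι) * ((p / Real.log p) *
          Real.log (max (Real.exp 1) (p * logHeight₁ x)) * ∏ i, logHeight₁ (ξ i)) := by ring
    _ ≤ pastenK ^ Fintype.card ι * ((p / Real.log p) *
          Real.log (max (Real.exp 1) (p * logHeight₁ x)) * ∏ i, logHeight₁ (ξ i)) := by
        apply mul_le_mul_of_nonneg_right (by linarith)
        have := hlogmax1 (p * logHeight₁ x)
        have : 0 ≤ p / Real.log p := by positivity
        positivity
    _ = _ := by ring

end Adapters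

/-! ### Assembly -/

section Assembly

variable {K : ℝ}

/-- **Stewart–Yu 2001, Theorem 1, from the `p`-adic clause and an archimedean bound with an
arbitrary constant.** If the `p`-adic clause of the approximation bound holds with some absolute
`K ≥ 1` (Yu-type lower bounds for linear forms in `p`-adic logarithms over `ℚ`, at every prime,
in Pasten's form (ii)), and linear forms in `2 ≤ n ≤ 4` logarithms of positive rationals admit
ANY lower bound of the shape `log |Λ| > −C(n) A₁⋯Aₙ log(eB)` (no condition on the constants
`C(2), C(3), C(4) ≥ 0`), then `BakerShapeBound (1/3) 3`: `log c ≤ κ R^{1/3} (log R)³` for all abc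
triples. Proof: w.l.o.g. `a ≤ b`; the triple `1 + 1 = 2` directly; if `c ≤ a²`, the cube of the
three `p`-adic routes (`log_le_of_le_sq`); if `a² < c`, the second regime (`log_le_of_sq_lt`,
`regimeII_endgame`). [cite: StewartYu2001, Theorem 1] -/
theorem bakerShapeBound_third_three_of_padicClause_archBound (hK : 1 ≤ K)
    (hP2 : ∀ (ι : Type) [Fintype ι], 0 < Fintype.card ι →
      ∀ ξ : ι → ℚ, (∀ i, ξ i ≠ 0 ∧ ξ i ≠ 1 ∧ ξ i ≠ -1) →
      ∀ ζ : ℚ, (ζ = 1 ∨ ζ = -1) → ∀ b : ι → ℤ, ζ * ∏ i, ξ i ^ b i ≠ 1 →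
      ∀ p : ℕ, p.Prime →
        (padicValRat p (1 - ζ * ∏ i, ξ i ^ b i) : ℝ) * Real.log p <
          K ^ Fintype.card ι * (p / Real.log p) *
            Real.log (max (Real.exp 1) (p * logHeight₁ (ζ * ∏ i, ξ i ^ b i))) *
            ∏ i, logHeight₁ (ξ i))
    (C : ℕ → ℝ) (hC0 : ∀ n, 2 ≤ n → 0 ≤ C n)
    (hA : ∀ (κ : Type) [Fintype κ], 2 ≤ Fintype.card κ → Fintype.card κ ≤ 4 →
      ∀ (α : κ → ℚ) (b : κ → ℤ) (A : κ → ℝ) (B : ℝ),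
        (∀ k, 0 < α k ∧ α k ≠ 1) → b ≠ 0 →
        ∑ k, (b k : ℝ) * Real.log (α k : ℝ) ≠ 0 →
        (∀ k, max (logHeight₁ (α k)) (max |Real.log (α k : ℝ)| 0.16) ≤ A k) →
        1 ≤ B → (∀ k, (|b k| : ℝ) ≤ B) →
        -(C (Fintype.card κ) * (∏ k, A k) * Real.log (Real.exp 1 * B)) <
          Real.log |∑ k, (b k : ℝ) * Real.log (α k : ℝ)|) :
    BakerShapeBound (1 / 3) 3 := by
  obtain ⟨Ca, hCa1, hCa⟩ := exists_prod_mul_log_sq_div_le (show (0 : ℝ) ≤ 4 * K ^ 2 by positivity)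
  obtain ⟨C₁, hC₁1, hC₁⟩ := exists_prod_two_mul_max_log_le (zero_le_one.trans hK)
  set κ₁ : ℝ := 64 * K ^ 3 * (2 * Ca) * (Real.log (16 * K ^ 3 * (2 * Ca)) + 3) with hκ₁
  set M₀ : ℝ := 58 * max 1 (max (max (C 2) (C 3)) (C 4)) * K * C₁ ^ 2 with hM₀
  set κ₂ : ℝ := 73728 * M₀ * (Real.log (32 * M₀) + 4) ^ 2 with hκ₂
  have hK3 : 1 ≤ K ^ 3 := one_le_pow₀ hK
  have hCa2 : 1 ≤ 2 * Ca := by linarith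
  have hc₀0 : 0 ≤ Real.log (16 * K ^ 3 * (2 * Ca)) := Real.log_nonneg (by nlinarith)
  have hκ₁192 : (192 : ℝ) ≤ κ₁ := by
    have h3 : (3 : ℝ) ≤ Real.log (16 * K ^ 3 * (2 * Ca)) + 3 := by linarith
    calc (192 : ℝ) = 64 * 1 * 1 * 3 := by norm_num
      _ ≤ 64 * K ^ 3 * (2 * Ca) * (Real.log (16 * K ^ 3 * (2 * Ca)) + 3) :=
          mul_le_mul (mul_le_mul (mul_le_mul_of_nonneg_left hK3 (by norm_num)) hCa2 zero_le_one
            (by positivity)) h3 (by norm_num) (by positivity)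
  have hM₀1 : 1 ≤ M₀ := by
    have h1 : (1 : ℝ) ≤ max 1 (max (max (C 2) (C 3)) (C 4)) := le_max_left _ _
    have h2 : (1 : ℝ) ≤ C₁ ^ 2 := one_le_pow₀ hC₁1
    calc (1 : ℝ) ≤ 58 * 1 * 1 * 1 := by norm_num
      _ ≤ 58 * max 1 (max (max (C 2) (C 3)) (C 4)) * K * C₁ ^ 2 :=
          mul_le_mul (mul_le_mul (mul_le_mul_of_nonneg_left h1 (by norm_num)) hK zero_le_one
            (by positivity)) h2 zero_le_one (by positivity)
  have hκ₂0 : 0 ≤ κ₂ := by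
    have : 0 ≤ M₀ := zero_le_one.trans hM₀1
    positivity
  -- w.l.o.g. `a ≤ b`
  suffices key : ∀ a b c : ℕ, IsABCTriple a b c → a ≤ b →
      Real.log c ≤ max κ₁ κ₂ * (rad a b c : ℝ) ^ (1 / 3 : ℝ) * Real.log (rad a b c : ℕ) ^ 3 by
    refine ⟨max κ₁ κ₂, fun a b c h => ?_⟩
    rcases le_total a b with hab | hba
    · exact key a b c h hab
    · have := key b a c h.swap hba
      rwa [rad_swap] at this
  intro a b c h hab
  obtain ⟨ha, hb, habc, hcop⟩ := id h
  have hR2 : (2 : ℝ) ≤ (rad a b c : ℝ) := by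
    have : 2 ≤ rad a b c := by
      rw [rad_def, Nat.two_le_radical_iff]
      calc 2 ≤ c := by omega
        _ ≤ a * b * c := Nat.le_mul_of_pos_left c (Nat.mul_pos ha hb)
    exact_mod_cast this
  set R : ℝ := ((rad a b c : ℕ) : ℝ) with hR
  have hlogR : 0 ≤ Real.log R := Real.log_nonneg (by linarith)
  have hRL : 0 ≤ R ^ (1 / 3 : ℝ) * Real.log R ^ 3 := by positivity
  by_cases h1 : 1 < a * b
  · rcases le_or_gt (c : ℝ) ((a : ℝ) ^ 2) with hca | hac2
    · -- first regime
      have h' := log_le_of_le_sq hK hP2 hCa1 hCa h hab hca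
      calc Real.log c ≤ κ₁ * R ^ (1 / 3 : ℝ) * Real.log R ^ 3 := h'
        _ = κ₁ * (R ^ (1 / 3 : ℝ) * Real.log R ^ 3) := by ring
        _ ≤ max κ₁ κ₂ * (R ^ (1 / 3 : ℝ) * Real.log R ^ 3) :=
            mul_le_mul_of_nonneg_right (le_max_left _ _) hRL
        _ = max κ₁ κ₂ * R ^ (1 / 3 : ℝ) * Real.log R ^ 3 := by ring
    · -- second regime
      have h' := log_le_of_sq_lt hK hP2 C hC0 hA hC₁ h hab h1 hac2
      have h'' : Real.log c ≤ M₀ * R ^ (7 / 24 : ℝ) * max 1 (Real.log R) ^ 3 *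
          Real.log (max (Real.exp 1) (2 * Real.log c)) ^ 2 := by
        rw [hM₀]; exact h'
      have h3 := regimeII_endgame hM₀1 hR2 h''
      calc Real.log c ≤ κ₂ * R ^ (1 / 3 : ℝ) * Real.log R ^ 3 := by rw [hκ₂]; exact h3
        _ = κ₂ * (R ^ (1 / 3 : ℝ) * Real.log R ^ 3) := by ring
        _ ≤ max κ₁ κ₂ * (R ^ (1 / 3 : ℝ) * Real.log R ^ 3) :=
            mul_le_mul_of_nonneg_right (le_max_right _ _) hRL
        _ = max κ₁ κ₂ * R ^ (1 / 3 : ℝ) * Real.log R ^ 3 := by ring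
  · -- the triple `1 + 1 = 2`
    have hab1 : a * b = 1 := by
      have : 1 ≤ a * b := Nat.mul_pos ha hb
      omega
    have ha1 : a = 1 := Nat.eq_one_of_mul_eq_one_right hab1
    have hb1 : b = 1 := Nat.eq_one_of_mul_eq_one_left hab1
    have hc2 : c = 2 := by omega
    have hκ : (192 : ℝ) ≤ max κ₁ κ₂ := hκ₁192.trans (le_max_left _ _)
    have hR13 : 1 ≤ R ^ (1 / 3 : ℝ) := Real.one_le_rpow (by linarith) (by norm_num)
    have hL : (0.69 : ℝ) ≤ Real.log R :=
      le_trans (by have := Real.log_two_gt_d9; linarith) (Real.log_le_log two_pos hR2)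
    have hL3 : (0.69 : ℝ) ^ 3 ≤ Real.log R ^ 3 := pow_le_pow_left₀ (by norm_num) hL 3
    have hlog2 : Real.log 2 ≤ 0.7 := by have := Real.log_two_lt_d9; linarith
    calc Real.log c = Real.log 2 := by rw [hc2]; norm_num
      _ ≤ 0.7 := hlog2
      _ ≤ 192 * 1 * (0.69 : ℝ) ^ 3 := by norm_num
      _ ≤ max κ₁ κ₂ * R ^ (1 / 3 : ℝ) * Real.log R ^ 3 :=
          mul_le_mul (mul_le_mul hκ hR13 zero_le_one (by linarith)) hL3 (by norm_num)
            (by positivity)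

/-- **`BakerMethodBounds` from the `p`-adic clause (constant `K ≥ 1`) and an archimedean bound
with an arbitrary constant** (`BakerMethodBounds = BakerShapeBound (1/3) 3` by definition).
[cite: StewartYu2001, Theorem 1] -/
theorem BakerMethodBounds_of_padicClause_archBound (hK : 1 ≤ K)
    (hP2 : ∀ (ι : Type) [Fintype ι], 0 < Fintype.card ι →
      ∀ ξ : ι → ℚ, (∀ i, ξ i ≠ 0 ∧ ξ i ≠ 1 ∧ ξ i ≠ -1) →
      ∀ ζ : ℚ, (ζ = 1 ∨ ζ = -1) → ∀ b : ι → ℤ, ζ * ∏ i, ξ i ^ b i ≠ 1 →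
      ∀ p : ℕ, p.Prime →
        (padicValRat p (1 - ζ * ∏ i, ξ i ^ b i) : ℝ) * Real.log p <
          K ^ Fintype.card ι * (p / Real.log p) *
            Real.log (max (Real.exp 1) (p * logHeight₁ (ζ * ∏ i, ξ i ^ b i))) *
            ∏ i, logHeight₁ (ξ i))
    (C : ℕ → ℝ) (hC0 : ∀ n, 2 ≤ n → 0 ≤ C n)
    (hA : ∀ (κ : Type) [Fintype κ], 2 ≤ Fintype.card κ → Fintype.card κ ≤ 4 →
      ∀ (α : κ → ℚ) (b : κ → ℤ) (A : κ → ℝ) (B : ℝ),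
        (∀ k, 0 < α k ∧ α k ≠ 1) → b ≠ 0 →
        ∑ k, (b k : ℝ) * Real.log (α k : ℝ) ≠ 0 →
        (∀ k, max (logHeight₁ (α k)) (max |Real.log (α k : ℝ)| 0.16) ≤ A k) →
        1 ≤ B → (∀ k, (|b k| : ℝ) ≤ B) →
        -(C (Fintype.card κ) * (∏ k, A k) * Real.log (Real.exp 1 * B)) <
          Real.log |∑ k, (b k : ℝ) * Real.log (α k : ℝ)|) :
    BakerMethodBounds :=
  bakerShapeBound_third_three_of_padicClause_archBound hK hP2 C hC0 hA

/-- **`BakerMethodBounds` from Evertse–Győry's Theorem 3.2.8 over `ℚ` at the FINITE places only,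
plus an archimedean bound with an arbitrary constant.** The hypothesis `h328` is the finite-place
half of the printed Theorem 3.2.8 for `K = ℚ` (as in `Dioph.evertseGyory_thm_4_2_1_rat_of_thm_3_2_8`,
and as PRODUCED by `Dioph.thm328_rat_finite_of_yu` from Yu's Theorem 3.2.7 over `ℚ`, or by
`Dioph.thm328_rat_finite_of_padicBound` from any `p`-adic bound of Yu's shape); `hA` is a lower
bound for linear forms in `2 ≤ n ≤ 4` logarithms of positive rationals with ANY constants
`C(n) ≥ 0`.
[cite: StewartYu2001, Theorem 1] [cite: EvertseGyory2015, Thm 3.2.8 (p. 62)] -/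
theorem BakerMethodBounds_of_thm328Finite_archBound
    (h328 : ∀ (ι : Type) [Fintype ι], 0 < Fintype.card ι →
      ∀ α : ι → ℚ, (∀ i, α i ≠ 0 ∧ α i ≠ 1 ∧ α i ≠ -1) →
      ∀ β : ℚ, β ≠ 0 → ∀ s : ℤ, (s = 1 ∨ s = -1) → ∀ b : ι → ℤ,
        (∏ i, α i ^ b i) * β ^ s - 1 ≠ 0 →
      ∀ B : ℝ, (∀ i, (|b i| : ℝ) ≤ B) →
        2 * Real.exp 1 * 9 ^ (Fintype.card ι + 1) * (∏ i, logHeight₁ (α i)) *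
            max (logHeight₁ β) 1 ≤ B →
        ∀ p : ℕ, p.Prime →
          -(egC6 (Fintype.card ι + 1) * (p / Real.log p) * (∏ i, logHeight₁ (α i)) *
              max (logHeight₁ β) 1 * logStar (B * p / max (logHeight₁ β) 1)) <
            -(padicValRat p ((∏ i, α i ^ b i) * β ^ s - 1) : ℝ) * Real.log p)
    (C : ℕ → ℝ) (hC0 : ∀ n, 2 ≤ n → 0 ≤ C n)
    (hA : ∀ (κ : Type) [Fintype κ], 2 ≤ Fintype.card κ → Fintype.card κ ≤ 4 →
      ∀ (α : κ → ℚ) (b : κ → ℤ) (A : κ → ℝ) (B : ℝ),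
        (∀ k, 0 < α k ∧ α k ≠ 1) → b ≠ 0 →
        ∑ k, (b k : ℝ) * Real.log (α k : ℝ) ≠ 0 →
        (∀ k, max (logHeight₁ (α k)) (max |Real.log (α k : ℝ)| 0.16) ≤ A k) →
        1 ≤ B → (∀ k, (|b k| : ℝ) ≤ B) →
        -(C (Fintype.card κ) * (∏ k, A k) * Real.log (Real.exp 1 * B)) <
          Real.log |∑ k, (b k : ℝ) * Real.log (α k : ℝ)|) :
    BakerMethodBounds :=
  BakerMethodBounds_of_padicClause_archBound one_le_pastenK (padicClause_of_thm328_finite h328)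
    C hC0 hA

/-- **`BakerMethodBounds` from Yu's Theorem 3.2.7 over `ℚ` as printed (Yu 2007) and an
archimedean bound with an arbitrary constant** — the archimedean input may be Matveev's
Theorem 3.2.4, Baker–Wüstholz 1993, or any weaker explicit bound of the same shape: the
Stewart–Yu exponent `1/3` is carried by the `p`-adic estimates alone.
The hypothesis `hY` is verbatim that of `Dioph.thm328_rat_finite_of_yu`.
[cite: StewartYu2001, Theorem 1] [cite: EvertseGyory2015, Thm 3.2.7 (p. 62)] -/
theorem BakerMethodBounds_of_yu_archBound
    (hY : ∀ (κ : Type) [Fintype κ] [DecidableEq κ], 2 ≤ Fintype.card κ →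
      ∀ (α : κ → ℚ) (b : κ → ℤ) (k₀ : κ) (B Bn δ : ℝ) (p : ℕ), p.Prime →
        (∀ k, α k ≠ 0) → b k₀ ≠ 0 →
        (∀ k, b k ≠ 0 → padicValInt p (b k₀) ≤ padicValInt p (b k)) →
        (∀ k, (|b k| : ℝ) ≤ B) → Bn ≤ B → (|b k₀| : ℝ) ≤ Bn →
        ∏ k, α k ^ b k - 1 ≠ 0 → 0 < δ → δ ≤ 1 / 2 →
        (padicValRat p (∏ k, α k ^ b k - 1) : ℝ) <
          (16 * Real.exp 1) ^ (2 * (Fintype.card κ + 1)) * (Fintype.card κ : ℝ) ^ (3 / 2 : ℝ) *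
              Real.log (2 * Fintype.card κ) * Real.log 2 *
            (p / Real.log p ^ 2) *
            max ((∏ k, max (logHeight₁ (α k)) (1 / (16 * Real.exp 1 ^ 2))) *
                  Real.log (Bn * (2 * Real.exp 1 ^ ((Fintype.card κ + 1) *
                      (6 * Fintype.card κ + 5)) * Real.log 2) * (p : ℝ) ^ (Fintype.card κ + 1) *
                    (∏ k ∈ univ.erase k₀, max (logHeight₁ (α k)) (1 / (16 * Real.exp 1 ^ 2))) /
                    δ))
              (δ * B / (Bn * (2 ^ (2 * Fintype.card κ + 1) * Real.log 2 * Real.log 3 ^ 3))))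
    (C : ℕ → ℝ) (hC0 : ∀ n, 2 ≤ n → 0 ≤ C n)
    (hA : ∀ (κ : Type) [Fintype κ], 2 ≤ Fintype.card κ → Fintype.card κ ≤ 4 →
      ∀ (α : κ → ℚ) (b : κ → ℤ) (A : κ → ℝ) (B : ℝ),
        (∀ k, 0 < α k ∧ α k ≠ 1) → b ≠ 0 →
        ∑ k, (b k : ℝ) * Real.log (α k : ℝ) ≠ 0 →
        (∀ k, max (logHeight₁ (α k)) (max |Real.log (α k : ℝ)| 0.16) ≤ A k) →
        1 ≤ B → (∀ k, (|b k| : ℝ) ≤ B) →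
        -(C (Fintype.card κ) * (∏ k, A k) * Real.log (Real.exp 1 * B)) <
          Real.log |∑ k, (b k : ℝ) * Real.log (α k : ℝ)|) :
    BakerMethodBounds :=
  BakerMethodBounds_of_thm328Finite_archBound (thm328_rat_finite_of_yu hY) C hC0 hA

/-- **`BakerMethodBounds` from the two GENERIC binders of
`Dioph.evertseGyory_thm_4_2_1_rat_of_archBound_padicBound`, WITHOUT the growth condition
`C(n) ≤ 2^{6n+20}` on the archimedean constant:** an archimedean lower bound over `ℚ` of the
shape of Evertse–Győry's Theorem 3.2.4 with any `C(n) ≥ 0`, and a `p`-adic upper bound of the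
shape of their Theorem 3.2.7 over `ℚ` with any `C₃(n)` subject to `C₃(n) · 7(n+1)² ≤ C₆(n,1)`.
[cite: StewartYu2001, Theorem 1] [cite: EvertseGyory2015, Thm 3.2.4 (p. 61), Thm 3.2.7 (p. 62)] -/
theorem BakerMethodBounds_of_archBound_padicBound (C C₃ : ℕ → ℝ)
    (hC0 : ∀ n, 2 ≤ n → 0 ≤ C n) (hC₃0 : ∀ n, 2 ≤ n → 0 ≤ C₃ n)
    (hC₃le : ∀ n, 2 ≤ n → C₃ n * (7 * ((n : ℝ) + 1) ^ 2) ≤ egC6 n)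
    (hM : ∀ (κ : Type) [Fintype κ], 2 ≤ Fintype.card κ →
      ∀ (a : κ → ℚ) (b : κ → ℤ) (A : κ → ℝ) (k₀ : κ) (B : ℝ),
        (∀ k, 0 < a k ∧ a k ≠ 1) → b ≠ 0 →
        ∑ k, (b k : ℝ) * Real.log (a k : ℝ) ≠ 0 →
        (∀ k, max (logHeight₁ (a k)) (max |Real.log (a k : ℝ)| 0.16) ≤ A k) →
        1 ≤ B → (∀ k, (|b k| : ℝ) * A k / A k₀ ≤ B) →
        -(C (Fintype.card κ) * (∏ k, A k) * Real.log (Real.exp 1 * B)) <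
          Real.log |∑ k, (b k : ℝ) * Real.log (a k : ℝ)|)
    (hY : ∀ (κ : Type) [Fintype κ] [DecidableEq κ], 2 ≤ Fintype.card κ →
      ∀ (α : κ → ℚ) (b : κ → ℤ) (k₀ : κ) (B Bn δ : ℝ) (p : ℕ), p.Prime →
        (∀ k, α k ≠ 0) → b k₀ ≠ 0 →
        (∀ k, b k ≠ 0 → padicValInt p (b k₀) ≤ padicValInt p (b k)) →
        (∀ k, (|b k| : ℝ) ≤ B) → Bn ≤ B → (|b k₀| : ℝ) ≤ Bn →
        ∏ k, α k ^ b k - 1 ≠ 0 → 0 < δ → δ ≤ 1 / 2 →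
        (padicValRat p (∏ k, α k ^ b k - 1) : ℝ) <
          C₃ (Fintype.card κ) * (p / Real.log p ^ 2) *
            max ((∏ k, max (logHeight₁ (α k)) (1 / (16 * Real.exp 1 ^ 2))) *
                  Real.log (Bn * (2 * Real.exp 1 ^ ((Fintype.card κ + 1) *
                      (6 * Fintype.card κ + 5)) * Real.log 2) * (p : ℝ) ^ (Fintype.card κ + 1) *
                    (∏ k ∈ univ.erase k₀, max (logHeight₁ (α k)) (1 / (16 * Real.exp 1 ^ 2))) /
                    δ))
              (δ * B / (Bn * (2 ^ (2 * Fintype.card κ + 1) * Real.log 2 * Real.log 3 ^ 3)))) :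
    BakerMethodBounds :=
  BakerMethodBounds_of_thm328Finite_archBound (thm328_rat_finite_of_padicBound C₃ hC₃0 hC₃le hY)
    C hC0 (archBound_crude_of_refined C hM)

/-- **Stewart–Yu 2001, Theorem 1 (`abc.S06`,
`Literature.NumberTheory.DiophantineGeometry.stewart_yu`) from Yu's Theorem 3.2.7 over `ℚ` and
an archimedean bound with an arbitrary constant.** [cite: StewartYu2001, Theorem 1] -/
theorem stewart_yu_of_yu_archBound
    (hY : ∀ (κ : Type) [Fintype κ] [DecidableEq κ], 2 ≤ Fintype.card κ →
      ∀ (α : κ → ℚ) (b : κ → ℤ) (k₀ : κ) (B Bn δ : ℝ) (p : ℕ), p.Prime →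
        (∀ k, α k ≠ 0) → b k₀ ≠ 0 →
        (∀ k, b k ≠ 0 → padicValInt p (b k₀) ≤ padicValInt p (b k)) →
        (∀ k, (|b k| : ℝ) ≤ B) → Bn ≤ B → (|b k₀| : ℝ) ≤ Bn →
        ∏ k, α k ^ b k - 1 ≠ 0 → 0 < δ → δ ≤ 1 / 2 →
        (padicValRat p (∏ k, α k ^ b k - 1) : ℝ) <
          (16 * Real.exp 1) ^ (2 * (Fintype.card κ + 1)) * (Fintype.card κ : ℝ) ^ (3 / 2 : ℝ) *
              Real.log (2 * Fintype.card κ) * Real.log 2 *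
            (p / Real.log p ^ 2) *
            max ((∏ k, max (logHeight₁ (α k)) (1 / (16 * Real.exp 1 ^ 2))) *
                  Real.log (Bn * (2 * Real.exp 1 ^ ((Fintype.card κ + 1) *
                      (6 * Fintype.card κ + 5)) * Real.log 2) * (p : ℝ) ^ (Fintype.card κ + 1) *
                    (∏ k ∈ univ.erase k₀, max (logHeight₁ (α k)) (1 / (16 * Real.exp 1 ^ 2))) /
                    δ))
              (δ * B / (Bn * (2 ^ (2 * Fintype.card κ + 1) * Real.log 2 * Real.log 3 ^ 3))))
    (C : ℕ → ℝ) (hC0 : ∀ n, 2 ≤ n → 0 ≤ C n)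
    (hA : ∀ (κ : Type) [Fintype κ], 2 ≤ Fintype.card κ → Fintype.card κ ≤ 4 →
      ∀ (α : κ → ℚ) (b : κ → ℤ) (A : κ → ℝ) (B : ℝ),
        (∀ k, 0 < α k ∧ α k ≠ 1) → b ≠ 0 →
        ∑ k, (b k : ℝ) * Real.log (α k : ℝ) ≠ 0 →
        (∀ k, max (logHeight₁ (α k)) (max |Real.log (α k : ℝ)| 0.16) ≤ A k) →
        1 ≤ B → (∀ k, (|b k| : ℝ) ≤ B) →
        -(C (Fintype.card κ) * (∏ k, A k) * Real.log (Real.exp 1 * B)) <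
          Real.log |∑ k, (b k : ℝ) * Real.log (α k : ℝ)|) :
    Literature.NumberTheory.DiophantineGeometry.stewart_yu :=
  BakerMethodBounds_of_yu_archBound hY C hC0 hA

end Assembly

end Literature.Barriers.ABC

end
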